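import Literature.NumberTheory.Sieve.MontgomeryVaughan1975Section6ExcRem
import Literature.NumberTheory.Sieve.MontgomeryVaughan1975Section7
import Literature.NumberTheory.Sieve.MontgomeryVaughan1975Lemma43
import HarnessLib

/-!
# Montgomery–Vaughan (1975), §6, exceptional case: the main terms, (6.1͂7), and `section6_formulae` — PROVED

H. L. Montgomery, R. C. Vaughan, *The exceptional set in Goldbach's problem*, Acta Arith. 27
(1975) 353–370 [MontgomeryVaughanActa1975], §6, pp. 364–365. Third and last layer of the discharge
of the second conjunct (6.1͂7) of the named fact `section6_formulae c₁` (`ErrorTerms`), on top of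
`Section6ExcT` (the sum `T̃`) and `Section6ExcRem` ((6.3~)–(6.8~), `majorArc_remainderExc_bound`):
the main terms `majorArcMainTermExc` of part R at one modulus `q`, the coefficient sums over `q`
((6.12~), (6.16~), (6.19), (6.20)), the assembly of (6.1͂7), and the DISCHARGE
`section6_formulae_holds (c₁) : section6_formulae c₁`.

* `majorArcMainTermExc_eq` — **(6.4~)**: for `q ≥ 1` the main terms are the main term of (6.4)
  (`majorArcMainTerm`) plus, when `r̃ ∣ q`,
  `φ(q)⁻² (2 c_{χ̃χ₀}(−n) τ(χ̄₀) τ((χ̃χ₀)‾) ∫ T T̃ e + c_{χ₀}(−n) τ((χ̃χ₀)‾)² ∫ T̃² e)` (`excJMain`, `excIMain`);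
* `lemma55Term_exc_one_le`, `sum_lemma55Term_exc_one_le` — **(6.20) as a bound**: the coefficients of
  `J̃` satisfy `∑_q φ(q)⁻² |c_{χ̃χ₀}(n)| |τ(χ̄₀)| |τ((χ̃χ₀)‾)| ≤ 𝟙_{(n,r̃)=1} e² (r̃/φ(r̃)²) (n/φ(n))`
  (LEMMAS 5.2, 5.4, keeping the factor `r̃/φ(r̃)²` that LEMMA 5.5 gives away); `norm_sum_excJMain_le`;
* `excMainCoeff_term_eq` — **(6.16~) termwise**: for `q = r̃k`,
  `φ(q)⁻² c_q(n) τ((χ̃χ₀)‾)² = χ̃(−1) r̃ c_{r̃}(n) φ(r̃)⁻² · 𝟙_{(k,r̃)=1} μ(k)² c_k(n) φ(k)⁻²` (LEMMA 5.1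
  `τ(χ̃)² = χ̃(−1)r̃`, LEMMA 5.2); `excMainCoeff_mul_div_eq`: with (5.2) this coefficient over
  `∏_{p∣r̃}(local factor)` is the tree's `excRatio χ̃ n = 𝔖̃(n)/𝔖(n)`;
* `hasSum_goldbachSeriesTermCoprime` — **(6.16~), the Euler product**: for even `n`,
  `∑_{(k,r̃)=1} μ(k)² c_k(n) φ(k)⁻² = 𝔖(n)/∏_{p∣r̃}(local factor of 𝔖(n) at p)`;
  `abs_sum_goldbachSeriesTermCoprime_sub_le` — completing the sum, (6.19);
* `norm_sum_excIMain_sub_le`, `norm_sum_majorArcMainTermExc_sub_le` — **(6.12~) with (6.19)**;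
* `excIMain_error_le` — absorbing `d(n)³ d(r̃)² log P` into `X^{δ}` (as in `Section6Main`);
* `majorArc_formula_exceptional` — **(6.1͂7)**; `section6_formulae_holds` — the named fact, both
  conjuncts, for every `c₁` (`section6_formulae_exists`); hence the §6 hypothesis of the tree's
  reductions (`MontgomeryVaughan1975Lemma43.lean`) is discharged:
  `majorArc_lowerBound_of_lemma43 : lemma43_gallagher → majorArc_lowerBound` ((8.3)) and
  `goldbachExceptionalCount_isBigO_rpow_of_lemma43 : lemma43_gallagher → goldbachExceptionalCount_isBigO_rpow`
  — Theorem 1 of the paper now rests exactly on the single named fact `lemma43_gallagher`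
  (LEMMA 4.3 = Gallagher 1970, Theorem 7; itself reduced in `MontgomeryVaughan1975Lemma43Assembly.lean`
  to the truncated explicit formulae and a log-free zero-density estimate).
-/

noncomputable section

open MeasureTheory Set Finset Real Complex Classical
open scoped FourierTransform ArithmeticFunction.Moebius

namespace Literature.NumberTheory.Sieve.MontgomeryVaughan1975

/-! ### (6.4~): the main terms at `q` made explicit -/

/-- `∫ (δT + δ̃T̃)(δ'T + δ̃'T̃) e = δδ' ∫T²e + (δδ̃' + δ̃δ') ∫TT̃e + δ̃δ̃' ∫T̃²e`. [folklore] -/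
theorem integral_mainProd_eq {T Tt e : ℝ → ℂ} (hT : Continuous T) (hTt : Continuous Tt)
    (he : Continuous e) (δ δt δ' δt' : ℂ) (a b : ℝ) :
    ∫ η in a..b, (δ * T η + δt * Tt η) * (δ' * T η + δt' * Tt η) * e η =
      δ * δ' * (∫ η in a..b, T η * T η * e η) + (δ * δt' + δt * δ') * (∫ η in a..b, T η * Tt η * e η) +
        δt * δt' * ∫ η in a..b, Tt η * Tt η * e η := by
  have h1 : ∀ η, (δ * T η + δt * Tt η) * (δ' * T η + δt' * Tt η) * e η =
      δ * δ' * (T η * T η * e η) + (δ * δt' + δt * δ') * (T η * Tt η * e η) + δt * δt' * (Tt η * Tt η * e η) :=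
    fun η => by ring
  simp_rw [h1]
  have i1 : IntervalIntegrable (fun η => δ * δ' * (T η * T η * e η)) volume a b :=
    Continuous.intervalIntegrable (by fun_prop) _ _
  have i2 : IntervalIntegrable (fun η => (δ * δt' + δt * δ') * (T η * Tt η * e η)) volume a b :=
    Continuous.intervalIntegrable (by fun_prop) _ _
  have i3 : IntervalIntegrable (fun η => δt * δt' * (Tt η * Tt η * e η)) volume a b :=
    Continuous.intervalIntegrable (by fun_prop) _ _
  rw [intervalIntegral.integral_add (i1.add i2) i3, intervalIntegral.integral_add i1 i2,
    intervalIntegral.integral_const_mul, intervalIntegral.integral_const_mul,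
    intervalIntegral.integral_const_mul]

/-- **(6.4~) at the modulus `q ≥ 1`**: the main terms are the first term of (6.4),
`φ(q)⁻² c_q(−n) τ(χ̄₀)² ∫ T² e` (`majorArcMainTerm`), plus — when `r̃ ∣ q` — the two new terms
`φ(q)⁻² (2 c_{χ̃χ₀}(−n) τ(χ̄₀) τ((χ̃χ₀)‾) ∫ T T̃ e + c_{(χ̃χ₀)²}(−n) τ((χ̃χ₀)‾)² ∫ T̃² e)`
(Montgomery–Vaughan 1975, p. 364, first two terms of (6.4~), for `χ̃` quadratic).
[cite: MontgomeryVaughanActa1975, §6 (6.4~)] -/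
theorem majorArcMainTermExc_eq (P Q X : ℝ) {r : ℕ} (χe : DirichletCharacter ℂ r) (β : ℝ) (n : ℕ)
    (q : ℕ) [NeZero q] :
    majorArcMainTermExc P Q X χe β n q = majorArcMainTerm P Q X n q +
      if h : r ∣ q then
        ((q.totient : ℂ)⁻¹) ^ 2 *
          (2 * charGauss (DirichletCharacter.changeLevel h χe) ((-(n : ℤ) : ℤ) : ZMod q) *
              gaussSum (1 : DirichletCharacter ℂ q)⁻¹ ZMod.stdAddChar *
              gaussSum (DirichletCharacter.changeLevel h χe)⁻¹ ZMod.stdAddChar *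
              (∫ η in (-(1 / (q * Q)))..(1 / (q * Q)), linSum P X η * excLinSum P X β η * (𝐞 (-(n * η)) : ℂ)) +
            charGauss (DirichletCharacter.changeLevel h χe * DirichletCharacter.changeLevel h χe)
                ((-(n : ℤ) : ℤ) : ZMod q) *
              (gaussSum (DirichletCharacter.changeLevel h χe)⁻¹ ZMod.stdAddChar) ^ 2 *
              ∫ η in (-(1 / (q * Q)))..(1 / (q * Q)),
                excLinSum P X β η * excLinSum P X β η * (𝐞 (-(n * η)) : ℂ))
      else 0 := by
  set hh : ℝ := 1 / (q * Q) with hhh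
  set τ' : DirichletCharacter ℂ q → ℂ := fun χ => gaussSum χ⁻¹ ZMod.stdAddChar with hτ'
  set cG : DirichletCharacter ℂ q → ℂ := fun χ => charGauss χ ((-(n : ℤ) : ℤ) : ZMod q) with hcG
  set T : ℝ → ℂ := linSum P X with hT
  set Tt : ℝ → ℂ := excLinSum P X β with hTt
  set e : ℝ → ℂ := fun η => (𝐞 (-(n * η)) : ℂ) with he
  set δ : DirichletCharacter ℂ q → ℂ := fun χ => if χ = 1 then 1 else 0 with hδ
  set δt : DirichletCharacter ℂ q → ℂ := fun χ => if IsExcChar χe χ then 1 else 0 with hδt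
  set J₀ : ℂ := ∫ η in (-hh)..hh, T η * T η * e η with hJ₀
  set Jt : ℂ := ∫ η in (-hh)..hh, T η * Tt η * e η with hJt
  set It : ℂ := ∫ η in (-hh)..hh, Tt η * Tt η * e η with hIt
  have hTc : Continuous T := by rw [hT]; unfold linSum; fun_prop
  have hTtc : Continuous Tt := by rw [hTt]; unfold excLinSum; fun_prop
  have hec : Continuous e := by rw [he]; fun_prop
  have hδsum : ∀ F : DirichletCharacter ℂ q → ℂ, ∑ χ : DirichletCharacter ℂ q, δ χ * F χ = F 1 :=
    fun F => by
      simp only [hδ]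
      rw [Finset.sum_eq_single_of_mem 1 (Finset.mem_univ _)
        (fun χ _ hχ => by rw [if_neg hχ, zero_mul]), if_pos rfl, one_mul]
  have hδtsum : ∀ F : DirichletCharacter ℂ q → ℂ, ∑ χ : DirichletCharacter ℂ q, δt χ * F χ =
      if h : r ∣ q then F (DirichletCharacter.changeLevel h χe) else 0 :=
    fun F => by simp only [hδt]; exact sum_excIndC_mul χe F
  have hI : ∀ χ χ' : DirichletCharacter ℂ q,
      ∫ η in (-hh)..hh, (δ χ * T η + δt χ * Tt η) * (δ χ' * T η + δt χ' * Tt η) * e η =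
        δ χ * δ χ' * J₀ + (δ χ * δt χ' + δt χ * δ χ') * Jt + δt χ * δt χ' * It := fun χ χ' =>
    integral_mainProd_eq hTc hTtc hec (δ χ) (δt χ) (δ χ') (δt χ') (-hh) hh
  rw [majorArcMainTermExc, dif_neg (NeZero.ne q), majorArcMainTerm, dif_neg (NeZero.ne q)]
  -- rewrite the integrals
  have hsum : ∑ χ : DirichletCharacter ℂ q, ∑ χ' : DirichletCharacter ℂ q,
      cG (χ * χ') * (τ' χ * τ' χ' *
        ∫ η in (-hh)..hh, (δ χ * T η + δt χ * Tt η) * (δ χ' * T η + δt χ' * Tt η) * e η) =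
      cG 1 * (τ' 1) ^ 2 * J₀ +
        if h : r ∣ q then
          (2 * cG (DirichletCharacter.changeLevel h χe) * τ' 1 * τ' (DirichletCharacter.changeLevel h χe) * Jt +
            cG (DirichletCharacter.changeLevel h χe * DirichletCharacter.changeLevel h χe) *
              (τ' (DirichletCharacter.changeLevel h χe)) ^ 2 * It)
        else 0 := by
    simp_rw [hI]
    have hsplit : ∀ χ χ' : DirichletCharacter ℂ q,
        cG (χ * χ') * (τ' χ * τ' χ' *
          (δ χ * δ χ' * J₀ + (δ χ * δt χ' + δt χ * δ χ') * Jt + δt χ * δt χ' * It)) =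
        δ χ * (δ χ' * (cG (χ * χ') * (τ' χ * τ' χ') * J₀)) +
          δ χ * (δt χ' * (cG (χ * χ') * (τ' χ * τ' χ') * Jt)) +
          δt χ * (δ χ' * (cG (χ * χ') * (τ' χ * τ' χ') * Jt)) +
          δt χ * (δt χ' * (cG (χ * χ') * (τ' χ * τ' χ') * It)) := by
      intro χ χ'; ring
    simp_rw [hsplit, Finset.sum_add_distrib, ← Finset.mul_sum]
    rw [hδsum, hδsum, hδsum, hδtsum, hδtsum, hδtsum]
    by_cases hr : r ∣ q
    · simp only [dif_pos hr]
      rw [hδsum, hδtsum, dif_pos hr]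
      simp only [one_mul, mul_one]
      ring
    · simp only [dif_neg hr]
      simp only [mul_one, add_zero]
      ring
  have hgoal : ∑ χ : DirichletCharacter ℂ q, ∑ χ' : DirichletCharacter ℂ q,
      charGauss (χ * χ') ((-(n : ℤ) : ℤ) : ZMod q) *
        (gaussSum χ⁻¹ ZMod.stdAddChar * gaussSum χ'⁻¹ ZMod.stdAddChar *
          ∫ η in (-(1 / (q * Q)))..(1 / (q * Q)),
            ((if χ = 1 then (1 : ℂ) else 0) * linSum P X η +
                (if IsExcChar χe χ then (1 : ℂ) else 0) * excLinSum P X β η) *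
              ((if χ' = 1 then (1 : ℂ) else 0) * linSum P X η +
                (if IsExcChar χe χ' then (1 : ℂ) else 0) * excLinSum P X β η) *
              (𝐞 (-(n * η)) : ℂ)) =
      ∑ χ : DirichletCharacter ℂ q, ∑ χ' : DirichletCharacter ℂ q,
        cG (χ * χ') * (τ' χ * τ' χ' *
          ∫ η in (-hh)..hh, (δ χ * T η + δt χ * Tt η) * (δ χ' * T η + δt χ' * Tt η) * e η) := by
    rfl
  rw [hgoal, hsum]
  by_cases hr : r ∣ q
  · simp only [dif_pos hr]
    simp only [hcG, hτ', hJ₀, hJt, hIt, hT, hTt, he, hhh]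
    ring
  · simp only [dif_neg hr]
    simp only [hcG, hτ', hJ₀, hT, he, hhh]
    ring

/-! ### (6.20) as a bound: the coefficients of `J̃` -/

/-- If `r ∣ (r/(r,n)) · s` with `(r, s) = 1` then `(n, r) = 1` (`r ≠ 0`). [folklore] -/
theorem coprime_of_dvd_redMod_mul {r n s : ℕ} (hr : r ≠ 0) (hs : s.Coprime r)
    (h : r ∣ redMod r n * s) : n.Coprime r := by
  have h1 : r ∣ redMod r n := (Nat.Coprime.dvd_of_dvd_mul_right hs.symm h)
  have h2 : redMod r n ≤ r := Nat.div_le_self r _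
  have h3 : r ≤ redMod r n := Nat.le_of_dvd (Nat.pos_of_ne_zero (by
    rw [redMod]; exact (Nat.div_ne_zero_iff_of_dvd (Nat.gcd_dvd_left r n)).mpr
      ⟨hr, Nat.gcd_ne_zero_left hr⟩)) h1
  have h4 : redMod r n = r := le_antisymm h2 h3
  rw [redMod] at h4
  have hg : Nat.gcd r n = 1 := by
    by_contra hne
    have h1lt : 1 < Nat.gcd r n :=
      lt_of_le_of_ne (Nat.gcd_pos_of_pos_left n (Nat.pos_of_ne_zero hr)) (Ne.symm hne)
    have := Nat.div_lt_self (Nat.pos_of_ne_zero hr) h1lt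
    omega
  rw [Nat.coprime_comm]
  exact hg

/-- **The coefficient of `J̃` at one modulus** (Montgomery–Vaughan 1975, p. 364–365, proof of (6.20)
via LEMMAS 5.2 and 5.4): for `χ̃` primitive mod `r̃` and `n ≥ 1`,
`φ(q)⁻² |c_{χ̃χ₀}(n)| |τ((χ̃χ₀)‾)| |τ(χ̄₀)| ≤ 𝟙_{(n,r̃)=1} (r̃/φ(r̃)²) · 𝟙_{r̃∣q} F(q/r̃)` with
`F(k) = μ(k)² 𝟙_{(k,r̃)=1}/(φ(k)φ(k/(k,n)))` (`lemma55Weight`). [cite: MontgomeryVaughanActa1975, §6 (6.20)] -/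
theorem lemma55Term_exc_one_le {r : ℕ} [NeZero r] {χe : DirichletCharacter ℂ r} (hχe : χe.IsPrimitive)
    {n : ℕ} (hn : n ≠ 0) (q : ℕ) :
    lemma55Term χe (1 : DirichletCharacter ℂ 1) n q ≤
      (if n.Coprime r then (r : ℝ) / (Nat.totient r : ℝ) ^ 2 else 0) *
        (if r ∣ q then lemma55Weight r n (q / r) else 0) := by
  have hr0 : r ≠ 0 := NeZero.ne r
  have hRHS0 : 0 ≤ (if n.Coprime r then (r : ℝ) / (Nat.totient r : ℝ) ^ 2 else 0) *
      (if r ∣ q then lemma55Weight r n (q / r) else 0) := by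
    apply mul_nonneg
    · split_ifs
      · positivity
      · exact le_rfl
    · split_ifs
      · exact lemma55Weight_nonneg _ _ _
      · exact le_rfl
  unfold lemma55Term
  by_cases h : r ∣ q ∧ 1 ∣ q ∧ q ≠ 0
  swap
  · rw [dif_neg h]; exact hRHS0
  rw [dif_pos h]
  obtain ⟨hrq, _, hq0⟩ := h
  haveI : NeZero q := ⟨hq0⟩
  rw [if_pos hrq]
  rw [if_pos hrq] at hRHS0
  set k := q / r with hk
  have hqk : q = r * k := (Nat.mul_div_cancel' hrq).symm
  rw [DirichletCharacter.changeLevel_one, mul_one, gaussSum_one_inv_eq_moebius]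
  -- the three factors
  have hτ := norm_gaussSum_changeLevel_inv_le hrq hχe
  have hc := norm_charGauss_changeLevel_le hrq hχe hn
  have hμ : ‖(μ q : ℂ)‖ ≤ 1 := by
    rw [Complex.norm_intCast]; exact_mod_cast ArithmeticFunction.abs_moebius_le_one
  by_cases hkc : Squarefree k ∧ k.Coprime r
  swap
  · -- `τ((χ̃χ₀)‾) = 0`
    rw [if_neg hkc, mul_zero] at hτ
    have h0 : ‖gaussSum (DirichletCharacter.changeLevel hrq χe)⁻¹ ZMod.stdAddChar‖ = 0 :=
      le_antisymm hτ (norm_nonneg _)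
    rw [h0, mul_zero, zero_mul, zero_div]
    exact hRHS0
  rw [if_pos hkc, mul_one] at hτ
  by_cases hrd : r ∣ redMod q n
  swap
  · rw [if_neg hrd, zero_mul, zero_mul] at hc
    have h0 : ‖charGauss (DirichletCharacter.changeLevel hrq χe) (n : ZMod q)‖ = 0 :=
      le_antisymm hc (norm_nonneg _)
    rw [h0, zero_mul, zero_mul, zero_div]
    exact hRHS0
  rw [if_pos hrd, one_mul] at hc
  -- now `(n, r) = 1`, `q₁ = r · k/(k,n)`
  have hrk : r.Coprime k := hkc.2.symm
  obtain ⟨hred, hredcop⟩ := redMod_mul hrk n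
  rw [← hqk] at hred
  have hnr : n.Coprime r := by
    refine coprime_of_dvd_redMod_mul hr0 ?_ (hred ▸ hrd)
    exact Nat.Coprime.coprime_dvd_left (Nat.div_dvd_of_dvd (Nat.gcd_dvd_left k n)) hkc.2
  rw [if_pos hnr, lemma55Weight_apply, if_pos hkc]
  have hredr : redMod r n = r := by
    rw [redMod, Nat.coprime_comm.mp hnr |>.gcd_eq_one, Nat.div_one]
  have hq1 : redMod q n = r * (k / Nat.gcd k n) := by rw [hred, hredr]; rfl
  have hcop' : r.Coprime (k / Nat.gcd k n) := by
    have := hredcop; rwa [hredr] at this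
  -- totients
  have hφq : (Nat.totient q : ℝ) = (Nat.totient r : ℝ) * (Nat.totient k : ℝ) := by
    rw [hqk, Nat.totient_mul hrk]; push_cast; ring
  have hφq1 : (Nat.totient (redMod q n) : ℝ) = (Nat.totient r : ℝ) * (Nat.totient (k / Nat.gcd k n) : ℝ) := by
    rw [hq1, Nat.totient_mul hcop']; push_cast; ring
  have hφr0 : (0 : ℝ) < Nat.totient r := by exact_mod_cast Nat.totient_pos.mpr (NeZero.pos r)
  have hk0 : k ≠ 0 := hkc.1.ne_zero
  have hφk0 : (0 : ℝ) < Nat.totient k := by exact_mod_cast Nat.totient_pos.mpr (Nat.pos_of_ne_zero hk0)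
  have hkd0 : k / Nat.gcd k n ≠ 0 := (Nat.div_ne_zero_iff_of_dvd (Nat.gcd_dvd_left k n)).mpr
    ⟨hk0, Nat.gcd_ne_zero_left hk0⟩
  have hφkd0 : (0 : ℝ) < Nat.totient (k / Nat.gcd k n) := by
    exact_mod_cast Nat.totient_pos.mpr (Nat.pos_of_ne_zero hkd0)
  have hφq10 : (0 : ℝ) < Nat.totient (redMod q n) := by rw [hφq1]; positivity
  have hdiv : ((Nat.totient q / Nat.totient (redMod q n) : ℕ) : ℝ) =
      (Nat.totient q : ℝ) / (Nat.totient (redMod q n) : ℝ) := by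
    rw [Nat.cast_div (totient_redMod_dvd hn) hφq10.ne']
  rw [hdiv] at hc
  have hsqrt : Real.sqrt r * Real.sqrt r = r := Real.mul_self_sqrt (Nat.cast_nonneg r)
  -- combine
  calc ‖charGauss (DirichletCharacter.changeLevel hrq χe) (n : ZMod q)‖ *
        ‖gaussSum (DirichletCharacter.changeLevel hrq χe)⁻¹ ZMod.stdAddChar‖ * ‖(μ q : ℂ)‖ /
          (Nat.totient q : ℝ) ^ 2
      ≤ ((Nat.totient q : ℝ) / (Nat.totient (redMod q n) : ℝ) * Real.sqrt r) * Real.sqrt r * 1 /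
          (Nat.totient q : ℝ) ^ 2 := by
        gcongr
    _ = ((Nat.totient q : ℝ) / (Nat.totient (redMod q n) : ℝ)) * (Real.sqrt r * Real.sqrt r) /
          (Nat.totient q : ℝ) ^ 2 := by ring
    _ = (r : ℝ) / (Nat.totient r : ℝ) ^ 2 *
          (1 / ((Nat.totient k : ℝ) * (Nat.totient (k / Nat.gcd k n) : ℝ))) := by
        rw [hsqrt, hφq1, hφq]
        field_simp

/-- **(6.20) as a bound** (Montgomery–Vaughan 1975, p. 365: the `J̃`-coefficients sum to
`μ(r̃)χ̃(n) r̃ φ(r̃)⁻² ∏_{p∤r̃}(…) ≪ χ̃(n)² r̃ φ(r̃)⁻² n φ(n)⁻¹`): over any finite set of moduli,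
`∑_q φ(q)⁻² |c_{χ̃χ₀}(n)| |τ((χ̃χ₀)‾)| |τ(χ̄₀)| ≤ 𝟙_{(n,r̃)=1} e² (r̃/φ(r̃)²) (n/φ(n))`.
[cite: MontgomeryVaughanActa1975, §6 (6.20)] -/
theorem sum_lemma55Term_exc_one_le {r : ℕ} [NeZero r] {χe : DirichletCharacter ℂ r}
    (hχe : χe.IsPrimitive) {n : ℕ} (hn : n ≠ 0) (S : Finset ℕ) :
    ∑ q ∈ S, lemma55Term χe (1 : DirichletCharacter ℂ 1) n q ≤
      (if n.Coprime r then (r : ℝ) / (Nat.totient r : ℝ) ^ 2 else 0) *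
        (Real.exp 2 * ((n : ℝ) / (Nat.totient n : ℝ))) := by
  set A : ℝ := if n.Coprime r then (r : ℝ) / (Nat.totient r : ℝ) ^ 2 else 0 with hA
  have hA0 : 0 ≤ A := by
    rw [hA]
    split_ifs
    · positivity
    · exact le_rfl
  have h1 : ∑ q ∈ S, lemma55Term χe (1 : DirichletCharacter ℂ 1) n q ≤
      ∑ q ∈ S, A * (if r ∣ q then lemma55Weight r n (q / r) else 0) :=
    Finset.sum_le_sum fun q _ => lemma55Term_exc_one_le hχe hn q
  refine h1.trans ?_
  rw [← Finset.mul_sum, ← Finset.sum_filter]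
  apply mul_le_mul_of_nonneg_left _ hA0
  -- reindex `q = r k`
  set N := S.sup id + 1 with hN
  have h2 : ∑ q ∈ S.filter (fun q => r ∣ q), lemma55Weight r n (q / r) ≤
      ∑ k ∈ Finset.range N, lemma55Weight r n k := by
    rw [← Finset.sum_image (f := fun k => lemma55Weight r n k) (s := S.filter (fun q => r ∣ q))
      (g := fun q => q / r) ?_]
    · refine Finset.sum_le_sum_of_subset_of_nonneg ?_ fun k _ _ => lemma55Weight_nonneg _ _ _
      intro k hk
      obtain ⟨q, hq, rfl⟩ := Finset.mem_image.mp hk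
      have hqS : q ∈ S := (Finset.mem_filter.mp hq).1
      have : q ≤ S.sup id := Finset.le_sup (f := id) hqS
      exact Finset.mem_range.mpr (lt_of_le_of_lt ((Nat.div_le_self q r).trans this) (Nat.lt_succ_self _))
    · intro q hq q' hq' h
      have hd : r ∣ q := (Finset.mem_filter.mp hq).2
      have hd' : r ∣ q' := (Finset.mem_filter.mp hq').2
      exact (Nat.div_left_inj hd hd').mp h
  refine h2.trans ((sum_lemma55Weight_le r hn N).trans ?_)
  apply mul_le_mul_of_nonneg_left _ (Real.exp_pos 2).le
  rw [← prod_primeFactors_div_eq hn]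
  refine prod_le_prod_of_subset_of_one_le_real (Finset.filter_subset _ _) fun p hp => ?_
  have : (2 : ℝ) ≤ p := by exact_mod_cast (Nat.prime_of_mem_primeFactors hp).two_le
  rw [le_div_iff₀ (by linarith)]; linarith


/-! ### (6.16~) termwise: the coefficient of `Ĩ` at `q = r̃k` -/

/-- `χ(−1)` is `±1`, a real number, for any Dirichlet character. [folklore] -/
theorem apply_neg_one_eq_re {r : ℕ} (χ : DirichletCharacter ℂ r) : χ (-1) = ((χ (-1)).re : ℂ) := by
  have h := Literature.NumberTheory.Sieve.LargeSieve.apply_neg_one_mul_self χ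
  rcases mul_self_eq_one_iff.mp h with h1 | h1 <;> rw [h1] <;> simp

/-- A quadratic character is its own inverse. [folklore] -/
theorem inv_eq_self_of_sq_eq_one {r : ℕ} {χ : DirichletCharacter ℂ r} (hχ : χ ^ 2 = 1) : χ⁻¹ = χ := by
  rw [sq] at hχ
  exact inv_eq_of_mul_eq_one_right hχ

/-- `χ̃(k)² = 𝟙_{(k, r̃) = 1}` for a quadratic character `χ̃` mod `r̃`. [folklore] -/
theorem sq_apply_natCast_of_sq_eq_one {r : ℕ} [NeZero r] {χ : DirichletCharacter ℂ r} (hχ : χ ^ 2 = 1)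
    (k : ℕ) : χ (k : ZMod r) ^ 2 = if k.Coprime r then 1 else 0 := by
  rw [← MulChar.pow_apply' χ two_ne_zero, hχ]
  by_cases hc : k.Coprime r
  · rw [if_pos hc, MulChar.one_apply (R' := ℂ) ((ZMod.isUnit_iff_coprime k r).mpr hc)]
  · rw [if_neg hc, MulChar.map_nonunit _ (mt (ZMod.isUnit_iff_coprime k r).mp hc)]

/-- The coefficient `χ̃(−1) r̃ c_{r̃}(n) φ(r̃)⁻²` of (6.16~) (Montgomery–Vaughan 1975, p. 365:
`𝔖̃(n) = χ̃(−1) μ(r̃/(r̃,n)) r̃ φ(r̃)⁻¹ φ(r̃/(r̃,n))⁻¹ ∏_{p∤r̃}(…)`, where by (5.2)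
`c_{r̃}(n) = μ(r̃/(r̃,n)) φ(r̃)/φ(r̃/(r̃,n))`). [cite: MontgomeryVaughanActa1975, §6 (6.16~)] -/
def excMainCoeff {r : ℕ} (χe : DirichletCharacter ℂ r) (n : ℕ) : ℝ :=
  (χe (-1)).re * r * (ramanujanDivisorSum n r : ℝ) / (Nat.totient r : ℝ) ^ 2

/-- **(6.16~) termwise** (Montgomery–Vaughan 1975, p. 365, via LEMMA 5.1 `τ(χ̃)² = χ̃(−1) r̃` and
LEMMA 5.2 `τ(χ̃χ₀) = μ(q/r̃) χ̃(q/r̃) τ(χ̃)`): for `χ̃` quadratic primitive mod `r̃ ∣ q`, `k = q/r̃`,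
`φ(q)⁻² c_{(χ̃χ₀)²}(−n) τ((χ̃χ₀)‾)² = χ̃(−1) r̃ c_{r̃}(n) φ(r̃)⁻² · 𝟙_{(k,r̃)=1} μ(k)² c_k(n) φ(k)⁻²`.
[cite: MontgomeryVaughanActa1975, §6 (6.16~)] -/
theorem excMainCoeff_term_eq {r q : ℕ} [NeZero r] [NeZero q] (h : r ∣ q) {χe : DirichletCharacter ℂ r}
    (hχe : χe.IsPrimitive) (h2 : χe ^ 2 = 1) (n : ℕ) :
    ((q.totient : ℂ)⁻¹) ^ 2 *
        (charGauss (DirichletCharacter.changeLevel h χe * DirichletCharacter.changeLevel h χe)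
            ((-(n : ℤ) : ℤ) : ZMod q) *
          (gaussSum (DirichletCharacter.changeLevel h χe)⁻¹ ZMod.stdAddChar) ^ 2) =
      (((excMainCoeff χe n * if (q / r).Coprime r then goldbachSeriesTerm n (q / r) else 0 : ℝ)) : ℂ) := by
  set k := q / r with hk
  have hqk : q = r * k := (Nat.mul_div_cancel' h).symm
  -- `(χ̃χ₀)² = χ₀`, `(χ̃χ₀)⁻¹ = χ̃χ₀`
  have hsq : DirichletCharacter.changeLevel h χe * DirichletCharacter.changeLevel h χe = 1 := by
    rw [← map_mul, ← sq, h2, map_one]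
  have hinv : (DirichletCharacter.changeLevel h χe)⁻¹ = DirichletCharacter.changeLevel h χe :=
    inv_eq_of_mul_eq_one_right hsq
  rw [hsq, hinv, charGauss_one_neg_natCast, gaussSum_changeLevel h χe]
  -- `τ(χ̃)² = χ̃(−1) r`
  have hτ2 : gaussSum χe ZMod.stdAddChar ^ 2 = χe (-1) * r := by
    rw [sq]
    have := Literature.NumberTheory.Sieve.LargeSieve.gaussSum_mul_gaussSum_inv hχe
    rwa [inv_eq_self_of_sq_eq_one h2] at this
  have hχk := sq_apply_natCast_of_sq_eq_one h2 k
  rw [← hk]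
  by_cases hc : k.Coprime r
  · rw [if_pos hc] at hχk
    rw [if_pos hc]
    have hrk : r.Coprime k := hc.symm
    have hcq : ramanujanDivisorSum n q = ramanujanDivisorSum n r * ramanujanDivisorSum n k := by
      rw [hqk]; exact (isMultiplicative_ramanujanDivisorSum n).map_mul_of_coprime hrk
    have hφq : (q.totient : ℂ) = (r.totient : ℂ) * (k.totient : ℂ) := by
      rw [hqk, Nat.totient_mul hrk]; push_cast; ring
    have hφr : (r.totient : ℂ) ≠ 0 := by exact_mod_cast (Nat.totient_pos.mpr (NeZero.pos r)).ne'
    have hk0 : k ≠ 0 := fun h0 => NeZero.ne q (by rw [hqk, h0, mul_zero])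
    have hφk : (k.totient : ℂ) ≠ 0 := by exact_mod_cast (Nat.totient_pos.mpr (Nat.pos_of_ne_zero hk0)).ne'
    have hexp : ((μ k : ℂ) * χe (k : ZMod r) * gaussSum χe ZMod.stdAddChar) ^ 2 =
        (μ k : ℂ) ^ 2 * (χe (k : ZMod r) ^ 2) * (gaussSum χe ZMod.stdAddChar ^ 2) := by ring
    rw [hexp, hχk, hτ2, hcq, hφq, apply_neg_one_eq_re χe, excMainCoeff, goldbachSeriesTerm_apply]
    push_cast
    field_simp
  · rw [if_neg hc] at hχk
    rw [if_neg hc, mul_zero]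
    have h0 : χe (k : ZMod r) = 0 := pow_eq_zero_iff (n := 2) (by norm_num) |>.mp hχk
    rw [h0]
    push_cast
    ring

/-- **`excMainCoeff` and `excRatio`** (the two forms of the coefficient of (6.16~), by (5.2)
`c_{r̃}(n) = μ(r̃/(r̃,n)) φ(r̃)/φ(r̃/(r̃,n))`): `excMainCoeff χ̃ n · (S/D) = excRatio χ̃ n · S` where
`D = ∏_{p∣r̃}` (local factor of 𝔖 at `p`), for `n ≥ 1`. [cite: MontgomeryVaughanActa1975, §6 (6.16~)] -/
theorem excMainCoeff_mul_div_eq {r : ℕ} [NeZero r] (χe : DirichletCharacter ℂ r) {n : ℕ} (hn : n ≠ 0)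
    (S : ℝ) :
    excMainCoeff χe n * (S / ∏ p ∈ r.primeFactors, singSeriesLocalFactor n p) =
      excRatio χe n * S := by
  -- `c_r(n) = μ(r/(r,n)) φ(r)/φ(r/(r,n))`, in `ℝ`
  have hc : (ramanujanDivisorSum n r : ℝ) =
      (μ (r / Nat.gcd r n) : ℝ) * ((Nat.totient r : ℝ) / (Nat.totient (r / Nat.gcd r n) : ℝ)) := by
    have h1 := charGauss_one_neg_natCast (q := r) n
    have hneg : ((-(n : ℤ) : ℤ) : ZMod r) = -((n : ℕ) : ZMod r) := by push_cast; ring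
    rw [hneg, charGauss_neg, MulChar.one_apply (R' := ℂ) isUnit_one.neg, one_mul,
      charGauss_one_eq hn] at h1
    have hφ0 : (0 : ℝ) < Nat.totient (redMod r n) := by
      exact_mod_cast Nat.totient_pos.mpr (Nat.pos_of_ne_zero (redMod_ne_zero (NeZero.ne r) hn))
    have hdiv : ((Nat.totient r / Nat.totient (redMod r n) : ℕ) : ℝ) =
        (Nat.totient r : ℝ) / (Nat.totient (redMod r n) : ℝ) := by
      rw [Nat.cast_div (totient_redMod_dvd hn) hφ0.ne']
    apply Complex.ofReal_injective
    have h2 : ((ramanujanDivisorSum n r : ℝ) : ℂ) = ((ramanujanDivisorSum n r : ℤ) : ℂ) := by norm_cast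
    rw [h2, ← h1]
    push_cast
    rw [← redMod]
    have h3 : ((Nat.totient r / Nat.totient (redMod r n) : ℕ) : ℂ) =
        (((Nat.totient r : ℝ) / (Nat.totient (redMod r n) : ℝ) : ℝ) : ℂ) := by
      rw [← hdiv]; norm_cast
    rw [h3]; push_cast; ring
  have hφr : (Nat.totient r : ℝ) ≠ 0 := by exact_mod_cast (Nat.totient_pos.mpr (NeZero.pos r)).ne'
  rw [excMainCoeff, excRatio, hc]
  field_simp

/-! ### (6.16~): the restricted singular series `∑_{(k,r̃)=1} μ(k)² c_k(n) φ(k)⁻²` -/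

/-- The summand of (6.16~) after factoring: `μ(k)² c_k(n) φ(k)⁻² 𝟙_{(k,r)=1}` as an arithmetic
function of `k`. [cite: MontgomeryVaughanActa1975, §6 (6.16~)] -/
def goldbachSeriesTermCoprime (n r : ℕ) : ArithmeticFunction ℝ :=
  ⟨fun k => if k.Coprime r then goldbachSeriesTerm n k else 0, by
    simp only [ArithmeticFunction.map_zero, ite_self]⟩

/-- Unfolding. [folklore] -/
theorem goldbachSeriesTermCoprime_apply (n r k : ℕ) :
    goldbachSeriesTermCoprime n r k = if k.Coprime r then goldbachSeriesTerm n k else 0 := rfl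

/-- The restricted summand is multiplicative. [folklore] -/
theorem isMultiplicative_goldbachSeriesTermCoprime (n r : ℕ) :
    (goldbachSeriesTermCoprime n r).IsMultiplicative := by
  refine ⟨?_, fun {a b} hab => ?_⟩
  · rw [goldbachSeriesTermCoprime_apply, if_pos (Nat.coprime_one_left r),
      (isMultiplicative_goldbachSeriesTerm n).map_one]
  · rw [goldbachSeriesTermCoprime_apply, goldbachSeriesTermCoprime_apply, goldbachSeriesTermCoprime_apply]
    by_cases ha : a.Coprime r
    · by_cases hb : b.Coprime r
      · rw [if_pos (Nat.Coprime.mul_left ha hb), if_pos ha, if_pos hb,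
          (isMultiplicative_goldbachSeriesTerm n).map_mul_of_coprime hab]
      · rw [if_neg (fun h => hb (Nat.Coprime.coprime_mul_left h)), if_neg hb, mul_zero]
    · rw [if_neg (fun h => ha (Nat.Coprime.coprime_mul_right h)), if_neg ha, zero_mul]

/-- `|restricted summand| ≤ |summand|`. [folklore] -/
theorem abs_goldbachSeriesTermCoprime_le (n r k : ℕ) :
    |goldbachSeriesTermCoprime n r k| ≤ |goldbachSeriesTerm n k| := by
  rw [goldbachSeriesTermCoprime_apply]
  split_ifs
  · exact le_rfl
  · rw [abs_zero]; exact abs_nonneg _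

/-- The local Euler factor: `∑_e F(p^e) = 1 + F(p)`. [folklore] -/
theorem tsum_goldbachSeriesTermCoprime_prime_pow (n r : ℕ) {p : ℕ} (hp : p.Prime) :
    ∑' e : ℕ, goldbachSeriesTermCoprime n r (p ^ e) = 1 + goldbachSeriesTermCoprime n r p := by
  rw [tsum_eq_sum (s := {0, 1})]
  · rw [Finset.sum_pair (by norm_num), pow_zero, pow_one,
      (isMultiplicative_goldbachSeriesTermCoprime n r).map_one]
  · intro e he
    simp only [Finset.mem_insert, Finset.mem_singleton, not_or] at he
    rw [goldbachSeriesTermCoprime_apply, goldbachSeriesTerm_apply,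
      ArithmeticFunction.moebius_apply_prime_pow hp (by omega), if_neg he.2]
    simp

/-- The local factor at `p`: `1 + F(p) = 1` if `p ∣ r`, and the local factor of `𝔖(n)` otherwise.
[cite: MontgomeryVaughanActa1975, §6 (6.16~)] -/
theorem one_add_goldbachSeriesTermCoprime_prime (n r : ℕ) {p : ℕ} (hp : p.Prime) :
    1 + goldbachSeriesTermCoprime n r p = if p ∣ r then 1 else singSeriesLocalFactor n p := by
  rw [goldbachSeriesTermCoprime_apply]
  by_cases hpr : p ∣ r
  · rw [if_pos hpr, if_neg (fun h => ((Nat.Prime.coprime_iff_not_dvd hp).mp h) hpr), add_zero]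
  · rw [if_neg hpr, if_pos ((Nat.Prime.coprime_iff_not_dvd hp).mpr hpr), goldbachSeriesTerm_prime n hp,
      singSeriesLocalFactor]
    split_ifs <;> ring

/-- `1 + μ(p)²c_p(n)/φ(p)²` is the local factor of `𝔖(n)`. [cite: MontgomeryVaughanActa1975, §6 (6.16)] -/
theorem one_add_goldbachSeriesTerm_prime (n : ℕ) {p : ℕ} (hp : p.Prime) :
    1 + goldbachSeriesTerm n p = singSeriesLocalFactor n p := by
  rw [goldbachSeriesTerm_prime n hp, singSeriesLocalFactor]
  split_ifs <;> ring

/-- **(6.16~), the Euler product** (Montgomery–Vaughan 1975, p. 365: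
`∑_{q≥1, r̃∣q} τ(χ̃χ₀)² c_q(−n) φ(q)⁻² = χ̃(−1) μ(r̃/(r̃,n)) r̃ φ(r̃)⁻¹ φ(r̃/(r̃,n))⁻¹
∏_{p∤r̃, p∤n}(1 − (p−1)⁻²) ∏_{p∤r̃, p∣n}(1 + (p−1)⁻¹)`): for even `n ≥ 1` and `r ≥ 1`,
`∑_{k ≥ 1, (k,r)=1} μ(k)² c_k(n) φ(k)⁻² = 𝔖(n) / ∏_{p∣r} (local factor of 𝔖(n) at p)`
(the Euler product of `𝔖(n)` with the factors at `p ∣ r` removed; they are nonzero for even `n`).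
[cite: MontgomeryVaughanActa1975, §6 (6.16~)] -/
theorem hasSum_goldbachSeriesTermCoprime {n : ℕ} (hn : n ≠ 0) (heven : Even n) {r : ℕ} (hr : r ≠ 0) :
    HasSum (fun k => goldbachSeriesTermCoprime n r k)
      (goldbachSingularSeries n / ∏ p ∈ r.primeFactors, singSeriesLocalFactor n p) := by
  set F := goldbachSeriesTermCoprime n r with hF
  set D : ℝ := ∏ p ∈ r.primeFactors, singSeriesLocalFactor n p with hD
  have hD0 : D ≠ 0 := (Finset.prod_pos fun p hp =>
    singSeriesLocalFactor_pos heven (Nat.prime_of_mem_primeFactors hp)).ne'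
  have hsumm : Summable (fun k => ‖F k‖) := by
    refine Summable.of_nonneg_of_le (fun k => norm_nonneg _) (fun k => ?_) (summable_norm_goldbachSeriesTerm hn)
    rw [Real.norm_eq_abs, Real.norm_eq_abs]
    exact abs_goldbachSeriesTermCoprime_le n r k
  -- Euler products
  have E1 : Filter.Tendsto (fun N : ℕ => ∏ p ∈ N.primesBelow, (1 + F p)) Filter.atTop
      (nhds (∑' k, F k)) := by
    have E := (isMultiplicative_goldbachSeriesTermCoprime n r).eulerProduct hsumm
    refine E.congr' (Filter.Eventually.of_forall fun N => Finset.prod_congr rfl fun p hp => ?_)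
    exact tsum_goldbachSeriesTermCoprime_prime_pow n r (Nat.mem_primesBelow.mp hp).2
  have E2 : Filter.Tendsto (fun N : ℕ => ∏ p ∈ N.primesBelow, (1 + goldbachSeriesTerm n p)) Filter.atTop
      (nhds (goldbachSingularSeries n)) := by
    have := tendsto_prod_primesBelow_goldbachSeriesTerm hn
    rwa [(hasSum_goldbachSeriesTerm hn).tsum_eq] at this
  -- for `N > r`: `∏_{p<N}(1 + g p) = D · ∏_{p<N}(1 + F p)`
  have hsplit : ∀ N : ℕ, r < N →
      ∏ p ∈ N.primesBelow, (1 + F p) = (∏ p ∈ N.primesBelow, (1 + goldbachSeriesTerm n p)) / D := by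
    intro N hN
    rw [eq_div_iff hD0]
    have hfil : N.primesBelow.filter (fun p => p ∣ r) = r.primeFactors := by
      ext p
      simp only [Finset.mem_filter, Nat.mem_primesBelow, Nat.mem_primeFactors]
      constructor
      · rintro ⟨⟨_, hp⟩, hpr⟩; exact ⟨hp, hpr, hr⟩
      · rintro ⟨hp, hpr, _⟩
        exact ⟨⟨lt_of_le_of_lt (Nat.le_of_dvd (Nat.pos_of_ne_zero hr) hpr) hN, hp⟩, hpr⟩
    rw [← Finset.prod_filter_mul_prod_filter_not N.primesBelow (fun p => p ∣ r) (fun p => 1 + F p),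
      ← Finset.prod_filter_mul_prod_filter_not N.primesBelow (fun p => p ∣ r)
        (fun p => 1 + goldbachSeriesTerm n p), hfil, hD]
    have h1 : ∏ p ∈ r.primeFactors, (1 + F p) = 1 := by
      refine Finset.prod_eq_one fun p hp => ?_
      rw [hF, one_add_goldbachSeriesTermCoprime_prime n r (Nat.prime_of_mem_primeFactors hp),
        if_pos (Nat.dvd_of_mem_primeFactors hp)]
    have h2 : ∏ p ∈ N.primesBelow.filter (fun p => ¬ p ∣ r), (1 + F p) =
        ∏ p ∈ N.primesBelow.filter (fun p => ¬ p ∣ r), (1 + goldbachSeriesTerm n p) := by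
      refine Finset.prod_congr rfl fun p hp => ?_
      obtain ⟨hp1, hp2⟩ := Finset.mem_filter.mp hp
      have hpp := (Nat.mem_primesBelow.mp hp1).2
      rw [hF, one_add_goldbachSeriesTermCoprime_prime n r hpp, if_neg hp2, one_add_goldbachSeriesTerm_prime n hpp]
    have h3 : ∏ p ∈ r.primeFactors, (1 + goldbachSeriesTerm n p) = ∏ p ∈ r.primeFactors, singSeriesLocalFactor n p :=
      Finset.prod_congr rfl fun p hp => one_add_goldbachSeriesTerm_prime n (Nat.prime_of_mem_primeFactors hp)
    rw [h1, h2, h3, one_mul, mul_comm]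
  have E3 : Filter.Tendsto (fun N : ℕ => ∏ p ∈ N.primesBelow, (1 + F p)) Filter.atTop
      (nhds (goldbachSingularSeries n / D)) := by
    refine (E2.div_const D).congr' ?_
    filter_upwards [Filter.eventually_gt_atTop r] with N hN
    exact (hsplit N hN).symm
  have hlim : ∑' k, F k = goldbachSingularSeries n / D := tendsto_nhds_unique E1 E3
  rw [← hlim]
  exact hsumm.of_norm.hasSum

/-- **Completing the restricted series** (Montgomery–Vaughan 1975, (6.19): extending the sums to all
`q` costs the tail): for even `n ≥ 1`, `r ≥ 1`, `Y ≥ 1`,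
`|∑_{k≤Y, (k,r)=1} μ(k)² c_k(n)/φ(k)² − 𝔖(n)/∏_{p∣r}(…)| ≤ K d(n)² Y^{−11/12}` with the constant of
`exists_tail_abs_goldbachSeriesTerm_le`. [cite: MontgomeryVaughanActa1975, §6 (6.19)] -/
theorem abs_sum_goldbachSeriesTermCoprime_sub_le {K : ℝ}
    (hK : ∀ n : ℕ, n ≠ 0 → ∀ P : ℝ, 1 ≤ P → ∀ M : ℕ,
      ∑ q ∈ Finset.Ioc ⌊P⌋₊ M, |goldbachSeriesTerm n q| ≤ K * (n.divisors.card : ℝ) ^ 2 * P ^ (-(11 / 12 : ℝ)))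
    {n : ℕ} (hn : n ≠ 0) (heven : Even n) {r : ℕ} (hr : r ≠ 0) {Y : ℝ} (hY : 1 ≤ Y) :
    |∑ k ∈ Finset.Icc 1 ⌊Y⌋₊, goldbachSeriesTermCoprime n r k -
        goldbachSingularSeries n / ∏ p ∈ r.primeFactors, singSeriesLocalFactor n p| ≤
      K * (n.divisors.card : ℝ) ^ 2 * Y ^ (-(11 / 12 : ℝ)) := by
  set N := ⌊Y⌋₊ with hN
  set g : ℕ → ℝ := fun k => goldbachSeriesTermCoprime n r k with hg
  set L : ℝ := goldbachSingularSeries n / ∏ p ∈ r.primeFactors, singSeriesLocalFactor n p with hL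
  have hg0 : g 0 = 0 := by simp [hg]
  have hIcc : ∑ k ∈ Finset.Icc 1 N, g k = ∑ k ∈ Finset.range (N + 1), g k := by
    rw [Finset.range_eq_Ico, show Finset.Icc 1 N = Finset.Ico 1 (N + 1) by
      ext q; simp only [Finset.mem_Icc, Finset.mem_Ico]; omega]
    rw [Finset.sum_eq_sum_Ico_succ_bot (Nat.succ_pos N), hg0, zero_add]
  have hlim := (hasSum_goldbachSeriesTermCoprime hn heven hr).tendsto_sum_nat
  have htail : Filter.Tendsto (fun M : ℕ => ∑ k ∈ Finset.Ioc N M, g k) Filter.atTop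
      (nhds (L - ∑ k ∈ Finset.Icc 1 N, g k)) := by
    have h1 : Filter.Tendsto (fun M : ℕ => ∑ k ∈ Finset.range (M + 1), g k - ∑ k ∈ Finset.range (N + 1), g k)
        Filter.atTop (nhds (L - ∑ k ∈ Finset.Icc 1 N, g k)) := by
      rw [hIcc]
      exact (hlim.comp (Filter.tendsto_add_atTop_nat 1)).sub_const _
    refine h1.congr' ?_
    filter_upwards [Filter.eventually_ge_atTop N] with M hM
    rw [← Finset.sum_Ico_eq_sub _ (by omega : N + 1 ≤ M + 1)]
    congr 1
    ext q; simp only [Finset.mem_Ico, Finset.mem_Ioc]; omega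
  have habs := (continuous_abs.tendsto _).comp htail
  have hbound : ∀ M : ℕ, |∑ k ∈ Finset.Ioc N M, g k| ≤ K * (n.divisors.card : ℝ) ^ 2 * Y ^ (-(11 / 12 : ℝ)) :=
    fun M => (Finset.abs_sum_le_sum_abs _ _).trans
      ((Finset.sum_le_sum fun k _ => abs_goldbachSeriesTermCoprime_le n r k).trans (hK n hn Y hY M))
  have := le_of_tendsto' habs fun M => hbound M
  rwa [abs_sub_comm] at this

/-- `|χ̃(−1) r̃ c_{r̃}(n) φ(r̃)⁻²| ≤ r̃ (r̃,n) d(n) φ(r̃)⁻²`. [folklore] -/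
theorem abs_excMainCoeff_le {r : ℕ} (χe : DirichletCharacter ℂ r) {n : ℕ} (hn : n ≠ 0) :
    |excMainCoeff χe n| ≤ (r : ℝ) * (Nat.gcd r n : ℝ) * (n.divisors.card : ℝ) / (Nat.totient r : ℝ) ^ 2 := by
  rw [excMainCoeff, abs_div, abs_mul, abs_mul, abs_of_nonneg (sq_nonneg (Nat.totient r : ℝ)), Nat.abs_cast]
  have hre : |(χe (-1)).re| ≤ 1 := (Complex.abs_re_le_norm _).trans (DirichletCharacter.norm_le_one χe _)
  have hc := abs_ramanujanDivisorSum_le hn r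
  have h0 : (0 : ℝ) ≤ (Nat.totient r : ℝ) ^ 2 := sq_nonneg _
  apply div_le_div_of_nonneg_right _ h0
  calc |(χe (-1)).re| * (r : ℝ) * |(ramanujanDivisorSum n r : ℝ)| ≤ 1 * (r : ℝ) * ((Nat.gcd r n : ℝ) * (n.divisors.card : ℝ)) := by
        gcongr
    _ = _ := by ring

/-! ### The exceptional main terms summed over `q ≤ P`: (6.12~), (6.19), (6.20) -/

/-- Reindexing a sum over the multiples of `r ≥ 1` in `[1, N]`: `q = rk`, `1 ≤ k ≤ N/r`. [folklore] -/
theorem sum_Icc_filter_dvd_eq_sum_mul {M : Type*} [AddCommMonoid M] {r : ℕ} (hr : 0 < r) (N : ℕ) (f : ℕ → M) :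
    ∑ q ∈ (Finset.Icc 1 N).filter (fun q => r ∣ q), f q = ∑ k ∈ Finset.Icc 1 (N / r), f (r * k) := by
  rw [← Finset.sum_image (s := Finset.Icc 1 (N / r)) (g := fun k => r * k) (f := f) (fun a _ b _ h =>
    Nat.eq_of_mul_eq_mul_left hr h)]
  congr 1
  ext q
  simp only [Finset.mem_filter, Finset.mem_Icc, Finset.mem_image]
  constructor
  · rintro ⟨⟨h1, h2⟩, k, rfl⟩
    refine ⟨k, ⟨?_, ?_⟩, rfl⟩
    · rcases Nat.eq_zero_or_pos k with h0 | h0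
      · subst h0; simp at h1
      · exact h0
    · exact (Nat.le_div_iff_mul_le hr).mpr (by rw [mul_comm]; exact h2)
  · rintro ⟨k, ⟨h1, h2⟩, rfl⟩
    refine ⟨⟨Nat.mul_pos hr h1, ?_⟩, dvd_mul_right r k⟩
    have := (Nat.le_div_iff_mul_le hr).mp h2
    rw [mul_comm]; exact this

/-- The `J̃`-term of (6.4~) at the modulus `q` (zero unless `r̃ ∣ q`):
`2 φ(q)⁻² c_{χ̃χ₀}(−n) τ(χ̄₀) τ((χ̃χ₀)‾) ∫_{−1/qQ}^{1/qQ} T T̃ e(−nη) dη`. [cite: MontgomeryVaughanActa1975, §6 (6.4~)] -/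
def excJMain (P Q X : ℝ) {r : ℕ} (χe : DirichletCharacter ℂ r) (β : ℝ) (n q : ℕ) : ℂ :=
  if hq : q = 0 then 0 else
    haveI : NeZero q := ⟨hq⟩
    if h : r ∣ q then
      ((q.totient : ℂ)⁻¹) ^ 2 *
        (2 * charGauss (DirichletCharacter.changeLevel h χe) ((-(n : ℤ) : ℤ) : ZMod q) *
          gaussSum (1 : DirichletCharacter ℂ q)⁻¹ ZMod.stdAddChar *
          gaussSum (DirichletCharacter.changeLevel h χe)⁻¹ ZMod.stdAddChar *
          ∫ η in (-(1 / (q * Q)))..(1 / (q * Q)), linSum P X η * excLinSum P X β η * (𝐞 (-(n * η)) : ℂ))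
    else 0

/-- The `Ĩ`-term of (6.4~) at the modulus `q` (zero unless `r̃ ∣ q`):
`φ(q)⁻² c_{(χ̃χ₀)²}(−n) τ((χ̃χ₀)‾)² ∫_{−1/qQ}^{1/qQ} T̃² e(−nη) dη`. [cite: MontgomeryVaughanActa1975, §6 (6.4~)] -/
def excIMain (P Q X : ℝ) {r : ℕ} (χe : DirichletCharacter ℂ r) (β : ℝ) (n q : ℕ) : ℂ :=
  if hq : q = 0 then 0 else
    haveI : NeZero q := ⟨hq⟩
    if h : r ∣ q then
      ((q.totient : ℂ)⁻¹) ^ 2 *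
        (charGauss (DirichletCharacter.changeLevel h χe * DirichletCharacter.changeLevel h χe)
            ((-(n : ℤ) : ℤ) : ZMod q) *
          (gaussSum (DirichletCharacter.changeLevel h χe)⁻¹ ZMod.stdAddChar) ^ 2 *
          ∫ η in (-(1 / (q * Q)))..(1 / (q * Q)), excLinSum P X β η * excLinSum P X β η * (𝐞 (-(n * η)) : ℂ))
    else 0

/-- (6.4~) at `q ≥ 1`: main terms `=` main term of (6.4) `+ J̃-term + Ĩ-term`. [cite: MontgomeryVaughanActa1975, §6 (6.4~)] -/
theorem majorArcMainTermExc_eq_add (P Q X : ℝ) {r : ℕ} (χe : DirichletCharacter ℂ r) (β : ℝ) (n : ℕ)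
    {q : ℕ} (hq : q ≠ 0) :
    majorArcMainTermExc P Q X χe β n q =
      majorArcMainTerm P Q X n q + excJMain P Q X χe β n q + excIMain P Q X χe β n q := by
  haveI : NeZero q := ⟨hq⟩
  rw [majorArcMainTermExc_eq P Q X χe β n q, excJMain, dif_neg hq, excIMain, dif_neg hq]
  by_cases hr : r ∣ q
  · simp only [dif_pos hr]; ring
  · simp only [dif_neg hr]; ring

/-- **The `J̃`-term at `q`, bounded** ((6.11~) `|∫ T T̃ e| ≤ |J̃(n)| + qQ/2 ≤ n + qQ/2` and the weight
of LEMMA 5.5 with `χ₂` trivial): `|J̃-term_q| ≤ 2 lemma55Term χ̃ 1 n q · (n + qQ/2)`.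
[cite: MontgomeryVaughanActa1975, §6 (6.12~)] -/
theorem norm_excJMain_le {P Q X : ℝ} (hP : 0 ≤ P) {r : ℕ} [NeZero r] (χe : DirichletCharacter ℂ r) {β : ℝ}
    (hβ : β ≤ 1) (n : ℕ) {q : ℕ} (hq : 1 ≤ q) (hqQ : 2 ≤ (q : ℝ) * Q) :
    ‖excJMain P Q X χe β n q‖ ≤
      2 * lemma55Term χe (1 : DirichletCharacter ℂ 1) n q * ((n : ℝ) + q * Q / 2) := by
  have hq0 : q ≠ 0 := by omega
  haveI : NeZero q := ⟨hq0⟩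
  have hl0 : 0 ≤ lemma55Term χe (1 : DirichletCharacter ℂ 1) n q := by
    unfold lemma55Term; split_ifs <;> positivity
  have hq0' : (0 : ℝ) < q := by exact_mod_cast hq
  have hQ0 : 0 < Q := by
    rcases le_or_gt Q 0 with hQ | hQ
    · have : (q : ℝ) * Q ≤ 0 := mul_nonpos_of_nonneg_of_nonpos hq0'.le hQ
      linarith
    · exact hQ
  rw [excJMain, dif_neg hq0]
  by_cases hr : r ∣ q
  swap
  · rw [dif_neg hr, norm_zero]; positivity
  rw [dif_pos hr]
  set h : ℝ := 1 / (q * Q) with hh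
  have hh0 : 0 < h := by rw [hh]; positivity
  have hh2 : h ≤ 1 / 2 := by rw [hh]; exact one_div_le_one_div_of_le (by norm_num) hqQ
  have hJ : ‖∫ η in (-h)..h, linSum P X η * excLinSum P X β η * (𝐞 (-(n * η)) : ℂ)‖ ≤ (n : ℝ) + q * Q / 2 := by
    have h1 := norm_integral_linSum_excLinSum_sub_le (P := P) (X := X) hP hβ hh0 hh2 n
    have h2 : 1 / (2 * h) = q * Q / 2 := by rw [hh]; field_simp
    have h3 : ‖(-(excCrossSum P X β n : ℂ))‖ ≤ n := by
      rw [norm_neg, Complex.norm_real, Real.norm_eq_abs, abs_of_nonneg (excCrossSum_nonneg P X β n)]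
      exact excCrossSum_le hβ n
    have h4 := norm_sub_norm_le (∫ η in (-h)..h, linSum P X η * excLinSum P X β η * (𝐞 (-(n * η)) : ℂ))
      (-(excCrossSum P X β n : ℂ))
    rw [h2] at h1
    linarith
  have hw := linWeight_eq_lemma55Term hr χe n
  rw [norm_mul, norm_pow, norm_inv, Complex.norm_natCast, norm_mul, norm_mul, norm_mul, norm_mul,
    Complex.norm_two]
  calc (q.totient : ℝ)⁻¹ ^ 2 *
        (2 * ‖charGauss (DirichletCharacter.changeLevel hr χe) ((-(n : ℤ) : ℤ) : ZMod q)‖ *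
            ‖gaussSum (1 : DirichletCharacter ℂ q)⁻¹ ZMod.stdAddChar‖ *
            ‖gaussSum (DirichletCharacter.changeLevel hr χe)⁻¹ ZMod.stdAddChar‖ *
          ‖∫ η in (-h)..h, linSum P X η * excLinSum P X β η * (𝐞 (-(n * η)) : ℂ)‖)
      = 2 * (((q.totient : ℝ)⁻¹) ^ 2 * ‖gaussSum (1 : DirichletCharacter ℂ q)⁻¹ ZMod.stdAddChar‖ *
          (‖charGauss (DirichletCharacter.changeLevel hr χe) ((-(n : ℤ) : ℤ) : ZMod q)‖ *
            ‖gaussSum (DirichletCharacter.changeLevel hr χe)⁻¹ ZMod.stdAddChar‖)) *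
          ‖∫ η in (-h)..h, linSum P X η * excLinSum P X β η * (𝐞 (-(n * η)) : ℂ)‖ := by ring
    _ = 2 * lemma55Term χe (1 : DirichletCharacter ℂ 1) n q *
          ‖∫ η in (-h)..h, linSum P X η * excLinSum P X β η * (𝐞 (-(n * η)) : ℂ)‖ := by rw [hw]
    _ ≤ 2 * lemma55Term χe (1 : DirichletCharacter ℂ 1) n q * ((n : ℝ) + q * Q / 2) :=
        mul_le_mul_of_nonneg_left hJ (by positivity)

/-- **The `J̃`-terms summed, (6.20)**: for `P ≥ 0`, `Q ≥ 2` and every `N` with `N ≤ P`,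
`|∑_{q≤N} J̃-term_q| ≤ 2 (n + PQ/2) 𝟙_{(n,r̃)=1} e² (r̃/φ(r̃)²) (n/φ(n))` (this is the error term
`O(χ̃(n)² r̃ n X/(φ(r̃)² φ(n)))` of (6.1͂7), as `PQ = X`, `n ≤ X`). [cite: MontgomeryVaughanActa1975, §6 (6.20)] -/
theorem norm_sum_excJMain_le {P Q X : ℝ} (hP : 0 ≤ P) (hQ : 2 ≤ Q) {r : ℕ} [NeZero r] {χe : DirichletCharacter ℂ r}
    (hχe : χe.IsPrimitive) {β : ℝ} (hβ : β ≤ 1) {n : ℕ} (hn : n ≠ 0) {N : ℕ} (hNP : (N : ℝ) ≤ P) :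
    ‖∑ q ∈ Finset.Icc 1 N, excJMain P Q X χe β n q‖ ≤
      2 * ((n : ℝ) + P * Q / 2) *
        ((if n.Coprime r then (r : ℝ) / (Nat.totient r : ℝ) ^ 2 else 0) *
          (Real.exp 2 * ((n : ℝ) / (Nat.totient n : ℝ)))) := by
  have hl0 : ∀ q, 0 ≤ lemma55Term χe (1 : DirichletCharacter ℂ 1) n q := fun q => by
    unfold lemma55Term; split_ifs <;> positivity
  calc ‖∑ q ∈ Finset.Icc 1 N, excJMain P Q X χe β n q‖
      ≤ ∑ q ∈ Finset.Icc 1 N, 2 * lemma55Term χe (1 : DirichletCharacter ℂ 1) n q * ((n : ℝ) + P * Q / 2) := by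
        refine (norm_sum_le _ _).trans (Finset.sum_le_sum fun q hq => ?_)
        rw [Finset.mem_Icc] at hq
        have hq1 : (1 : ℝ) ≤ q := by exact_mod_cast hq.1
        have hqP : (q : ℝ) ≤ P := le_trans (by exact_mod_cast hq.2) hNP
        have hqQ : 2 ≤ (q : ℝ) * Q := by nlinarith
        refine (norm_excJMain_le hP χe hβ n hq.1 hqQ).trans ?_
        have : (q : ℝ) * Q / 2 ≤ P * Q / 2 := by nlinarith
        have h2l : 0 ≤ 2 * lemma55Term χe (1 : DirichletCharacter ℂ 1) n q := by linarith [hl0 q]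
        nlinarith
    _ = 2 * ((n : ℝ) + P * Q / 2) * ∑ q ∈ Finset.Icc 1 N, lemma55Term χe (1 : DirichletCharacter ℂ 1) n q := by
        rw [Finset.mul_sum]; exact Finset.sum_congr rfl fun q _ => by ring
    _ ≤ _ := by
        apply mul_le_mul_of_nonneg_left (sum_lemma55Term_exc_one_le hχe hn _)
        have : 0 ≤ P * Q := by nlinarith
        positivity

/-- **The `Ĩ`-terms summed, (6.12~) with (6.19) and (6.16~)** (Montgomery–Vaughan 1975, p. 364–365):
for `P ≥ 1`, `Q ≥ 2`, `X ≥ 0`, `r̃ ≤ P`, `χ̃` quadratic primitive, `β̃ ≤ 1`, even `n ≥ 1`,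
`|∑_{q≤P} Ĩ-term_q − 𝔖(n) (𝔖̃(n)/𝔖(n)) Ĩ(n)| ≤ |χ̃(−1) r̃ c_{r̃}(n) φ(r̃)⁻²| ·
(X K₁ d(n)² (P/r̃)^{−11/12} + (r̃Q/2) K₂ d(n)² (P/r̃)^{1/24} (1 + log(P/r̃)))`
(`K₁, K₂` the constants of the tail lemmas of `Section6Main`). [cite: MontgomeryVaughanActa1975, §6 (6.19)] -/
theorem norm_sum_excIMain_sub_le {K₁ K₂ : ℝ}
    (hK₁ : ∀ n : ℕ, n ≠ 0 → ∀ P : ℝ, 1 ≤ P → ∀ M : ℕ,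
      ∑ q ∈ Finset.Ioc ⌊P⌋₊ M, |goldbachSeriesTerm n q| ≤ K₁ * (n.divisors.card : ℝ) ^ 2 * P ^ (-(11 / 12 : ℝ)))
    (hK₂ : ∀ n : ℕ, n ≠ 0 → ∀ P : ℝ, 1 ≤ P →
      ∑ q ∈ Finset.Icc 1 ⌊P⌋₊, (q : ℝ) * |goldbachSeriesTerm n q| ≤
        K₂ * (n.divisors.card : ℝ) ^ 2 * P ^ (1 / 24 : ℝ) * (1 + Real.log P))
    {P Q X : ℝ} (hQ : 2 ≤ Q) (hX : 0 ≤ X) {r : ℕ} [NeZero r] {χe : DirichletCharacter ℂ r}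
    (hχe : χe.IsPrimitive) (h2 : χe ^ 2 = 1) (hrP : (r : ℝ) ≤ P) {β : ℝ} (hβ : β ≤ 1) {n : ℕ} (hn : n ≠ 0)
    (heven : Even n) :
    ‖∑ q ∈ Finset.Icc 1 ⌊P⌋₊, excIMain P Q X χe β n q -
        ((goldbachSingularSeries n * (excRatio χe n * excPairSum P X β n) : ℝ) : ℂ)‖ ≤
      |excMainCoeff χe n| *
        (X * (K₁ * (n.divisors.card : ℝ) ^ 2 * (P / r) ^ (-(11 / 12 : ℝ))) +
          (r * Q / 2) * (K₂ * (n.divisors.card : ℝ) ^ 2 * (P / r) ^ (1 / 24 : ℝ) * (1 + Real.log (P / r)))) := by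
  have hr0 : 0 < r := NeZero.pos r
  have hr0' : (0 : ℝ) < r := by exact_mod_cast hr0
  have hP1 : 1 ≤ P := le_trans (by exact_mod_cast hr0) hrP
  have hP0 : 0 ≤ P := by linarith
  have hY : 1 ≤ P / r := by rwa [le_div_iff₀ hr0', one_mul]
  set N := ⌊P⌋₊ with hN
  set A : ℝ := excMainCoeff χe n with hA
  set gt : ℕ → ℝ := fun k => goldbachSeriesTermCoprime n r k with hgt
  set It : ℕ → ℂ := fun q => ∫ η in (-(1 / (q * Q)))..(1 / (q * Q)),
    excLinSum P X β η * excLinSum P X β η * (𝐞 (-(n * η)) : ℂ) with hIt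
  set I0 : ℝ := excPairSum P X β n with hI0
  set L : ℝ := goldbachSingularSeries n / ∏ p ∈ r.primeFactors, singSeriesLocalFactor n p with hL
  have hNr : N / r = ⌊P / r⌋₊ := by rw [hN, Nat.floor_div_natCast]
  -- Step 1: only multiples of `r` contribute; reindex `q = rk`
  have hterm : ∀ q ∈ Finset.Icc 1 N, excIMain P Q X χe β n q =
      if r ∣ q then (((A * gt (q / r) : ℝ)) : ℂ) * It q else 0 := by
    intro q hq
    rw [Finset.mem_Icc] at hq
    have hq0 : q ≠ 0 := by omega
    haveI : NeZero q := ⟨hq0⟩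
    rw [excIMain, dif_neg hq0]
    by_cases hrq : r ∣ q
    · rw [dif_pos hrq, if_pos hrq, ← mul_assoc, excMainCoeff_term_eq hrq hχe h2 n]
      rfl
    · rw [dif_neg hrq, if_neg hrq]
  have hsum1 : ∑ q ∈ Finset.Icc 1 N, excIMain P Q X χe β n q =
      ∑ k ∈ Finset.Icc 1 (N / r), (((A * gt k : ℝ)) : ℂ) * It (r * k) := by
    rw [Finset.sum_congr rfl hterm, ← Finset.sum_filter, sum_Icc_filter_dvd_eq_sum_mul hr0]
    refine Finset.sum_congr rfl fun k _ => ?_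
    rw [Nat.mul_div_cancel_left k hr0]
  -- Step 2: split `It(rk) = I0 + (It(rk) − I0)` and `∑ gt = L + (∑ gt − L)`
  have hsplit : ∑ k ∈ Finset.Icc 1 (N / r), (((A * gt k : ℝ)) : ℂ) * It (r * k) -
      ((goldbachSingularSeries n * (excRatio χe n * I0) : ℝ) : ℂ) =
      (((A * I0 * (∑ k ∈ Finset.Icc 1 (N / r), gt k - L) : ℝ)) : ℂ) +
        ∑ k ∈ Finset.Icc 1 (N / r), (((A * gt k : ℝ)) : ℂ) * (It (r * k) - I0) := by
    have hmain : goldbachSingularSeries n * (excRatio χe n * I0) = A * I0 * L := by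
      rw [hA, hL]
      have := excMainCoeff_mul_div_eq χe hn (goldbachSingularSeries n)
      calc goldbachSingularSeries n * (excRatio χe n * I0) = (excRatio χe n * goldbachSingularSeries n) * I0 := by ring
        _ = excMainCoeff χe n * (goldbachSingularSeries n / ∏ p ∈ r.primeFactors, singSeriesLocalFactor n p) * I0 := by
            rw [this]
        _ = _ := by ring
    rw [hmain]
    push_cast
    rw [mul_sub, Finset.mul_sum]
    have : ∀ k ∈ Finset.Icc 1 (N / r), (A : ℂ) * (gt k : ℂ) * It (r * k) =
        (A : ℂ) * (I0 : ℂ) * (gt k : ℂ) + (A : ℂ) * (gt k : ℂ) * (It (r * k) - (I0 : ℂ)) := fun k _ => by ring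
    rw [Finset.sum_congr rfl this, Finset.sum_add_distrib]
    ring
  -- Step 3: the two error terms
  have hI00 : 0 ≤ I0 := excPairSum_nonneg P X β n
  have hI0X : I0 ≤ X := excPairSum_le hX hβ n
  have htail : |∑ k ∈ Finset.Icc 1 (N / r), gt k - L| ≤ K₁ * (n.divisors.card : ℝ) ^ 2 * (P / r) ^ (-(11 / 12 : ℝ)) := by
    rw [hNr]
    exact abs_sum_goldbachSeriesTermCoprime_sub_le hK₁ hn heven hr0.ne' hY
  have hwin : ∀ k ∈ Finset.Icc 1 (N / r), ‖It (r * k) - I0‖ ≤ (r * k : ℝ) * Q / 2 := by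
    intro k hk
    rw [Finset.mem_Icc] at hk
    have hk1 : (1 : ℝ) ≤ k := by exact_mod_cast hk.1
    have hrk0 : (0 : ℝ) < r * k := by positivity
    have hh0 : 0 < 1 / ((r * k : ℝ) * Q) := by positivity
    have hrkQ : 2 ≤ (r * k : ℝ) * Q := by
      have : (1 : ℝ) ≤ r * k := by nlinarith [show (1 : ℝ) ≤ r by exact_mod_cast hr0]
      nlinarith
    have hh2 : 1 / ((r * k : ℝ) * Q) ≤ 1 / 2 := one_div_le_one_div_of_le (by norm_num) hrkQ
    have h1 := norm_integral_excLinSum_sq_sub_le (P := P) (X := X) hP0 hβ hh0 hh2 n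
    have h2 : 1 / (2 * (1 / ((r * k : ℝ) * Q))) = (r * k : ℝ) * Q / 2 := by field_simp
    rw [h2] at h1
    simp only [hIt, hI0]
    push_cast
    exact h1
  have hwinsum : ‖∑ k ∈ Finset.Icc 1 (N / r), (((A * gt k : ℝ)) : ℂ) * (It (r * k) - I0)‖ ≤
      |A| * ((r * Q / 2) * (K₂ * (n.divisors.card : ℝ) ^ 2 * (P / r) ^ (1 / 24 : ℝ) * (1 + Real.log (P / r)))) := by
    calc ‖∑ k ∈ Finset.Icc 1 (N / r), (((A * gt k : ℝ)) : ℂ) * (It (r * k) - I0)‖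
        ≤ ∑ k ∈ Finset.Icc 1 (N / r), |A| * |gt k| * ((r * k : ℝ) * Q / 2) := by
          refine (norm_sum_le _ _).trans (Finset.sum_le_sum fun k hk => ?_)
          rw [norm_mul, Complex.norm_real, Real.norm_eq_abs, abs_mul]
          exact mul_le_mul_of_nonneg_left (hwin k hk) (by positivity)
      _ = |A| * (r * Q / 2) * ∑ k ∈ Finset.Icc 1 (N / r), (k : ℝ) * |gt k| := by
          rw [Finset.mul_sum]; exact Finset.sum_congr rfl fun k _ => by ring
      _ ≤ |A| * (r * Q / 2) * ∑ k ∈ Finset.Icc 1 (N / r), (k : ℝ) * |goldbachSeriesTerm n k| := by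
          apply mul_le_mul_of_nonneg_left _ (by positivity)
          exact Finset.sum_le_sum fun k _ => mul_le_mul_of_nonneg_left
            (abs_goldbachSeriesTermCoprime_le n r k) (Nat.cast_nonneg k)
      _ ≤ |A| * (r * Q / 2) * (K₂ * (n.divisors.card : ℝ) ^ 2 * (P / r) ^ (1 / 24 : ℝ) * (1 + Real.log (P / r))) := by
          apply mul_le_mul_of_nonneg_left _ (by positivity)
          rw [hNr]
          exact hK₂ n hn (P / r) hY
      _ = _ := by ring
  -- Step 4: combine
  rw [hsum1, hsplit]
  refine (norm_add_le _ _).trans ?_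
  rw [mul_add]
  refine add_le_add ?_ hwinsum
  rw [Complex.norm_real, Real.norm_eq_abs, abs_mul, abs_mul, abs_of_nonneg hI00, mul_assoc]
  apply mul_le_mul_of_nonneg_left _ (abs_nonneg A)
  exact mul_le_mul hI0X htail (abs_nonneg _) hX

/-- **(6.12~)–(6.20) assembled: the exceptional main terms summed over `q ≤ P`**: under the hypotheses
of `norm_sum_excIMain_sub_le` and `2P < Q`,
`|∑_{q≤P} majorArcMainTermExc − 𝔖(n)(n + (𝔖̃(n)/𝔖(n)) Ĩ(n))| ≤ |∑_{q≤P} majorArcMainTerm − 𝔖(n)n|`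
`+ 2(n + PQ/2) 𝟙_{(n,r̃)=1} e² (r̃/φ(r̃)²)(n/φ(n)) + |χ̃(−1) r̃ c_{r̃}(n) φ(r̃)⁻²| (X K₁ d(n)² (P/r̃)^{−11/12} +
(r̃Q/2) K₂ d(n)² (P/r̃)^{1/24}(1 + log(P/r̃)))`. [cite: MontgomeryVaughanActa1975, §6 (6.17~)] -/
theorem norm_sum_majorArcMainTermExc_sub_le {K₁ K₂ : ℝ}
    (hK₁ : ∀ n : ℕ, n ≠ 0 → ∀ P : ℝ, 1 ≤ P → ∀ M : ℕ,
      ∑ q ∈ Finset.Ioc ⌊P⌋₊ M, |goldbachSeriesTerm n q| ≤ K₁ * (n.divisors.card : ℝ) ^ 2 * P ^ (-(11 / 12 : ℝ)))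
    (hK₂ : ∀ n : ℕ, n ≠ 0 → ∀ P : ℝ, 1 ≤ P →
      ∑ q ∈ Finset.Icc 1 ⌊P⌋₊, (q : ℝ) * |goldbachSeriesTerm n q| ≤
        K₂ * (n.divisors.card : ℝ) ^ 2 * P ^ (1 / 24 : ℝ) * (1 + Real.log P))
    {P Q X : ℝ} (hQ : 2 ≤ Q) (hX : 0 ≤ X) {r : ℕ} [NeZero r] {χe : DirichletCharacter ℂ r}
    (hχe : χe.IsPrimitive) (h2 : χe ^ 2 = 1) (hrP : (r : ℝ) ≤ P) {β : ℝ} (hβ : β ≤ 1) {n : ℕ} (hn : n ≠ 0)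
    (heven : Even n) :
    ‖∑ q ∈ Finset.Icc 1 ⌊P⌋₊, majorArcMainTermExc P Q X χe β n q -
        ((goldbachSingularSeries n * (n + excRatio χe n * excPairSum P X β n) : ℝ) : ℂ)‖ ≤
      ‖∑ q ∈ Finset.Icc 1 ⌊P⌋₊, majorArcMainTerm P Q X n q - ((goldbachSingularSeries n * n : ℝ) : ℂ)‖ +
        2 * ((n : ℝ) + P * Q / 2) *
          ((if n.Coprime r then (r : ℝ) / (Nat.totient r : ℝ) ^ 2 else 0) *
            (Real.exp 2 * ((n : ℝ) / (Nat.totient n : ℝ)))) +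
        |excMainCoeff χe n| *
          (X * (K₁ * (n.divisors.card : ℝ) ^ 2 * (P / r) ^ (-(11 / 12 : ℝ))) +
            (r * Q / 2) * (K₂ * (n.divisors.card : ℝ) ^ 2 * (P / r) ^ (1 / 24 : ℝ) * (1 + Real.log (P / r)))) := by
  have hr0 : 0 < r := NeZero.pos r
  have hP1 : 1 ≤ P := le_trans (by exact_mod_cast hr0) hrP
  have hP0 : 0 ≤ P := by linarith
  set N := ⌊P⌋₊ with hN
  have hNP : (N : ℝ) ≤ P := Nat.floor_le hP0
  have hdecomp : ∑ q ∈ Finset.Icc 1 N, majorArcMainTermExc P Q X χe β n q =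
      ∑ q ∈ Finset.Icc 1 N, majorArcMainTerm P Q X n q + ∑ q ∈ Finset.Icc 1 N, excJMain P Q X χe β n q +
        ∑ q ∈ Finset.Icc 1 N, excIMain P Q X χe β n q := by
    rw [← Finset.sum_add_distrib, ← Finset.sum_add_distrib]
    refine Finset.sum_congr rfl fun q hq => ?_
    rw [Finset.mem_Icc] at hq
    exact majorArcMainTermExc_eq_add P Q X χe β n (by omega)
  have hJ := norm_sum_excJMain_le (X := X) hP0 hQ hχe hβ hn hNP
  have hI := norm_sum_excIMain_sub_le hK₁ hK₂ hQ hX hχe h2 hrP hβ hn heven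
  rw [hdecomp]
  have hsplit : ∑ q ∈ Finset.Icc 1 N, majorArcMainTerm P Q X n q + ∑ q ∈ Finset.Icc 1 N, excJMain P Q X χe β n q +
        ∑ q ∈ Finset.Icc 1 N, excIMain P Q X χe β n q -
      ((goldbachSingularSeries n * (n + excRatio χe n * excPairSum P X β n) : ℝ) : ℂ) =
      (∑ q ∈ Finset.Icc 1 N, majorArcMainTerm P Q X n q - ((goldbachSingularSeries n * n : ℝ) : ℂ)) +
        ∑ q ∈ Finset.Icc 1 N, excJMain P Q X χe β n q +
        (∑ q ∈ Finset.Icc 1 N, excIMain P Q X χe β n q -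
          ((goldbachSingularSeries n * (excRatio χe n * excPairSum P X β n) : ℝ) : ℂ)) := by
    push_cast; ring
  rw [hsplit]
  exact (norm_add₃_le).trans (add_le_add (add_le_add le_rfl hJ) hI)


/-! ### Crude arithmetic: `r/φ(r) ≤ d(r)` and the size of the coefficient of `Ĩ` -/

/-- `m/φ(m) = ∏_{p∣m} p/(p−1) ≤ 2^{ω(m)} ≤ d(m)` for `m ≥ 1`. [folklore] -/
theorem self_div_totient_le_card_divisors {m : ℕ} (hm : m ≠ 0) :
    (m : ℝ) / (Nat.totient m : ℝ) ≤ (m.divisors.card : ℝ) := by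
  rw [← prod_primeFactors_div_eq hm]
  calc ∏ p ∈ m.primeFactors, ((p : ℝ) / ((p : ℝ) - 1)) ≤ ∏ p ∈ m.primeFactors, (2 : ℝ) := by
        refine Finset.prod_le_prod (fun p hp => ?_) (fun p hp => ?_)
        · have h2 : (2 : ℝ) ≤ p := by exact_mod_cast (Nat.prime_of_mem_primeFactors hp).two_le
          have : (0 : ℝ) < (p : ℝ) - 1 := by linarith
          positivity
        · have h2 : (2 : ℝ) ≤ p := by exact_mod_cast (Nat.prime_of_mem_primeFactors hp).two_le
          rw [div_le_iff₀ (by linarith)]; linarith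
    _ = 2 ^ m.primeFactors.card := by rw [Finset.prod_const]
    _ ≤ (m.divisors.card : ℝ) := by
        exact_mod_cast GoldbachSeries.two_pow_card_primeFactors_le_card_divisors hm

/-- `|χ̃(−1) r̃ c_{r̃}(n) φ(r̃)⁻²| ≤ (r̃,n) d(n) d(r̃)² / r̃` (`|c_r(n)| ≤ (r,n)d(n)`, `r/φ(r) ≤ d(r)`). [folklore] -/
theorem abs_excMainCoeff_le' {r : ℕ} [NeZero r] (χe : DirichletCharacter ℂ r) {n : ℕ} (hn : n ≠ 0) :
    |excMainCoeff χe n| ≤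
      (Nat.gcd r n : ℝ) * (n.divisors.card : ℝ) * (r.divisors.card : ℝ) ^ 2 / (r : ℝ) := by
  have hr0 : r ≠ 0 := NeZero.ne r
  have hr : (0 : ℝ) < r := by exact_mod_cast Nat.pos_of_ne_zero hr0
  have hφ : (0 : ℝ) < Nat.totient r := by exact_mod_cast Nat.totient_pos.mpr (Nat.pos_of_ne_zero hr0)
  have h1 := abs_excMainCoeff_le χe hn
  have h2 := self_div_totient_le_card_divisors hr0
  have h3 : (r : ℝ) / (Nat.totient r : ℝ) ^ 2 ≤ (r.divisors.card : ℝ) ^ 2 / r := by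
    have : (r : ℝ) / (Nat.totient r : ℝ) ^ 2 = ((r : ℝ) / (Nat.totient r : ℝ)) ^ 2 / r := by
      field_simp
    rw [this]
    exact div_le_div_of_nonneg_right (pow_le_pow_left₀ (by positivity) h2 2) hr.le
  calc |excMainCoeff χe n| ≤ (r : ℝ) * (Nat.gcd r n : ℝ) * (n.divisors.card : ℝ) / (Nat.totient r : ℝ) ^ 2 := h1
    _ = (Nat.gcd r n : ℝ) * (n.divisors.card : ℝ) * ((r : ℝ) / (Nat.totient r : ℝ) ^ 2) := by ring
    _ ≤ (Nat.gcd r n : ℝ) * (n.divisors.card : ℝ) * ((r.divisors.card : ℝ) ^ 2 / r) :=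
        mul_le_mul_of_nonneg_left h3 (by positivity)
    _ = _ := by ring

/-! ### Absorbing the crude factors: the error of the `Ĩ`-terms is `O(X^{1+δ}P⁻¹(n,r̃))` -/

/-- **Bookkeeping for (6.19)**: with `P = X^{6δ}`, `Q = X^{1−6δ}`, `1 ≤ r ≤ P`, `1 ≤ n ≤ X`, the divisor
bound `d(m) ≤ C_d m^{δ/40}` and the thresholds `2K₁C_d⁵ ≤ X^{δ/4}`, `K₂C_d⁵(1 + 6δ log X) ≤ X^{δ/2}`
(`X ≥ 1`, `0 < δ ≤ 1/24`):
`((r,n) d(n) d(r)²/r) (X K₁ d(n)² (P/r)^{−11/12} + (rQ/2) K₂ d(n)² (P/r)^{1/24}(1 + log(P/r))) ≤ X^{1+δ}P⁻¹ (n,r)`.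
[cite: MontgomeryVaughanActa1975, §6 (6.19)] -/
theorem excIMain_error_le {K₁ K₂ Cd δ X : ℝ} (hK₁ : 0 ≤ K₁) (hK₂ : 0 ≤ K₂) (hCd : 0 ≤ Cd) (hδ : 0 < δ)
    (hδ' : δ ≤ 1 / 24) (hX1 : 1 ≤ X) (hA : 2 * K₁ * Cd ^ 5 ≤ X ^ (δ / 4))
    (hB : K₂ * Cd ^ 5 * (1 + 6 * δ * Real.log X) ≤ X ^ (δ / 2))
    {r n : ℕ} (hr : 1 ≤ r) (hrP : (r : ℝ) ≤ X ^ (6 * δ)) (hnX : (n : ℝ) ≤ X)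
    (hdn : (n.divisors.card : ℝ) ≤ Cd * (n : ℝ) ^ (δ / 40)) (hdr : (r.divisors.card : ℝ) ≤ Cd * (r : ℝ) ^ (δ / 40)) :
    (Nat.gcd r n : ℝ) * (n.divisors.card : ℝ) * (r.divisors.card : ℝ) ^ 2 / (r : ℝ) *
        (X * (K₁ * (n.divisors.card : ℝ) ^ 2 * (X ^ (6 * δ) / r) ^ (-(11 / 12 : ℝ))) +
          (r * X ^ (1 - 6 * δ) / 2) * (K₂ * (n.divisors.card : ℝ) ^ 2 * (X ^ (6 * δ) / r) ^ (1 / 24 : ℝ) *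
            (1 + Real.log (X ^ (6 * δ) / r)))) ≤
      X ^ (1 + δ) * (X ^ (6 * δ))⁻¹ * (Nat.gcd n r : ℝ) := by
  have hX0 : 0 < X := by linarith
  set P : ℝ := X ^ (6 * δ) with hP
  set Q : ℝ := X ^ (1 - 6 * δ) with hQ
  have hP0 : 0 < P := Real.rpow_pos_of_pos hX0 _
  have hr0 : (0 : ℝ) < r := by exact_mod_cast hr
  have hr1 : (1 : ℝ) ≤ r := by exact_mod_cast hr
  have hPr1 : 1 ≤ P / r := by rwa [le_div_iff₀ hr0, one_mul]
  have hPrP : P / r ≤ P := div_le_self hP0.le hr1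
  have hPX : P ≤ X := by
    rw [hP]
    calc X ^ (6 * δ) ≤ X ^ (1 : ℝ) := Real.rpow_le_rpow_of_exponent_le hX1 (by linarith)
      _ = X := Real.rpow_one X
  have hrX : (r : ℝ) ≤ X := hrP.trans hPX
  set dn : ℝ := (n.divisors.card : ℝ) with hdn'
  set dr : ℝ := (r.divisors.card : ℝ) with hdr'
  set g : ℝ := (Nat.gcd r n : ℝ) with hg
  have hg' : (Nat.gcd n r : ℝ) = g := by rw [hg, Nat.gcd_comm]
  have hdn0 : 0 ≤ dn := Nat.cast_nonneg _
  have hdr0 : 0 ≤ dr := Nat.cast_nonneg _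
  have hg0 : 0 ≤ g := Nat.cast_nonneg _
  -- `d(n)³ d(r)² ≤ Cd⁵ X^{δ/8}`
  have hXe : ∀ m : ℝ, 0 ≤ m → m ≤ X → m ^ (δ / 40) ≤ X ^ (δ / 40) := fun m hm hmX =>
    Real.rpow_le_rpow hm hmX (by linarith)
  have hdnX : dn ≤ Cd * X ^ (δ / 40) :=
    hdn.trans (mul_le_mul_of_nonneg_left (hXe n (Nat.cast_nonneg n) hnX) hCd)
  have hdrX : dr ≤ Cd * X ^ (δ / 40) :=
    hdr.trans (mul_le_mul_of_nonneg_left (hXe r hr0.le hrX) hCd)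
  have hY0 : 0 ≤ Cd * X ^ (δ / 40) := by positivity
  have hd5 : dn ^ 3 * dr ^ 2 ≤ Cd ^ 5 * X ^ (δ / 8) := by
    have h5 : (X ^ (δ / 40)) ^ 5 = X ^ (δ / 8) := by
      rw [← Real.rpow_natCast, ← Real.rpow_mul hX0.le]; ring_nf
    calc dn ^ 3 * dr ^ 2 ≤ (Cd * X ^ (δ / 40)) ^ 3 * (Cd * X ^ (δ / 40)) ^ 2 :=
          mul_le_mul (pow_le_pow_left₀ hdn0 hdnX 3) (pow_le_pow_left₀ hdr0 hdrX 2) (by positivity) (by positivity)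
      _ = Cd ^ 5 * (X ^ (δ / 40)) ^ 5 := by ring
      _ = Cd ^ 5 * X ^ (δ / 8) := by rw [h5]
  -- powers of `P`
  have hPs : P ^ (-(11 / 12 : ℝ)) = X ^ (-(11 / 2 * δ)) := by rw [hP, ← Real.rpow_mul hX0.le]; ring_nf
  have hP24 : P ^ (1 / 24 : ℝ) = X ^ (δ / 4) := by rw [hP, ← Real.rpow_mul hX0.le]; ring_nf
  have hlogP : Real.log P = 6 * δ * Real.log X := by rw [hP, Real.log_rpow hX0]
  -- `(P/r)^{-11/12} / r ≤ P^{-11/12}`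
  have hT1a : (P / r) ^ (-(11 / 12 : ℝ)) / r ≤ P ^ (-(11 / 12 : ℝ)) := by
    rw [Real.div_rpow hP0.le hr0.le, div_div, Real.rpow_neg hP0.le, Real.rpow_neg hr0.le]
    rw [show (P ^ (11 / 12 : ℝ))⁻¹ / (((r : ℝ) ^ (11 / 12 : ℝ))⁻¹ * r) =
        (P ^ (11 / 12 : ℝ))⁻¹ * ((r : ℝ) ^ (11 / 12 : ℝ) / r) by
      field_simp]
    have h1 : (r : ℝ) ^ (11 / 12 : ℝ) / r ≤ 1 := by
      rw [div_le_one hr0]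
      calc (r : ℝ) ^ (11 / 12 : ℝ) ≤ (r : ℝ) ^ (1 : ℝ) := Real.rpow_le_rpow_of_exponent_le hr1 (by norm_num)
        _ = r := Real.rpow_one _
    calc (P ^ (11 / 12 : ℝ))⁻¹ * ((r : ℝ) ^ (11 / 12 : ℝ) / r) ≤ (P ^ (11 / 12 : ℝ))⁻¹ * 1 :=
          mul_le_mul_of_nonneg_left h1 (by positivity)
      _ = _ := mul_one _
  -- `(P/r)^{1/24} ≤ P^{1/24}`, `log(P/r) ≤ log P`
  have hT2a : (P / r) ^ (1 / 24 : ℝ) ≤ P ^ (1 / 24 : ℝ) :=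
    Real.rpow_le_rpow (by positivity) hPrP (by norm_num)
  have hT2b : 1 + Real.log (P / r) ≤ 1 + Real.log P := by
    have := Real.log_le_log (by positivity) hPrP; linarith
  have hlog0 : 0 ≤ 1 + Real.log (P / r) := by
    have := Real.log_nonneg hPr1; linarith
  have hlogX0 : 0 ≤ Real.log X := Real.log_nonneg hX1
  -- exponent bookkeeping
  have e1 : X ^ (δ / 4) * X ^ (δ / 8) * (X * X ^ (-(11 / 2 * δ))) ≤ X ^ (1 - 5 * δ) := by
    have : X ^ (δ / 4) * X ^ (δ / 8) * (X * X ^ (-(11 / 2 * δ))) = X ^ (1 - 41 / 8 * δ) := by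
      have hX1' : X = X ^ (1 : ℝ) := (Real.rpow_one X).symm
      conv_lhs => rw [show X * X ^ (-(11 / 2 * δ)) = X ^ (1 : ℝ) * X ^ (-(11 / 2 * δ)) by rw [← hX1']]
      rw [← Real.rpow_add hX0, ← Real.rpow_add hX0, ← Real.rpow_add hX0]; ring_nf
    rw [this]
    exact Real.rpow_le_rpow_of_exponent_le hX1 (by linarith)
  have e2 : X ^ (δ / 2) * X ^ (δ / 8) * (X ^ (1 - 6 * δ) * X ^ (δ / 4)) ≤ X ^ (1 - 5 * δ) := by
    have : X ^ (δ / 2) * X ^ (δ / 8) * (X ^ (1 - 6 * δ) * X ^ (δ / 4)) = X ^ (1 - 41 / 8 * δ) := by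
      rw [← Real.rpow_add hX0, ← Real.rpow_add hX0, ← Real.rpow_add hX0]; ring_nf
    rw [this]
    exact Real.rpow_le_rpow_of_exponent_le hX1 (by linarith)
  have e3 : X ^ (1 + δ) * (X ^ (6 * δ))⁻¹ = X ^ (1 - 5 * δ) := (rpow_bookkeeping (δ := δ) hX0).2.2
  -- Term 1
  have hT1 : g * dn * dr ^ 2 / r * (X * (K₁ * dn ^ 2 * (P / r) ^ (-(11 / 12 : ℝ)))) ≤ X ^ (1 - 5 * δ) * g / 2 := by
    have hre : g * dn * dr ^ 2 / r * (X * (K₁ * dn ^ 2 * (P / r) ^ (-(11 / 12 : ℝ)))) =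
        g * (K₁ * (dn ^ 3 * dr ^ 2)) * X * ((P / r) ^ (-(11 / 12 : ℝ)) / r) := by ring
    rw [hre]
    calc g * (K₁ * (dn ^ 3 * dr ^ 2)) * X * ((P / r) ^ (-(11 / 12 : ℝ)) / r)
        ≤ g * (K₁ * (Cd ^ 5 * X ^ (δ / 8))) * X * P ^ (-(11 / 12 : ℝ)) := by
          apply mul_le_mul _ hT1a (by positivity) (by positivity)
          gcongr
      _ = g * (2 * K₁ * Cd ^ 5) * X ^ (δ / 8) * (X * X ^ (-(11 / 2 * δ))) / 2 := by rw [hPs]; ring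
      _ ≤ g * X ^ (δ / 4) * X ^ (δ / 8) * (X * X ^ (-(11 / 2 * δ))) / 2 := by gcongr
      _ = g * (X ^ (δ / 4) * X ^ (δ / 8) * (X * X ^ (-(11 / 2 * δ)))) / 2 := by ring
      _ ≤ g * X ^ (1 - 5 * δ) / 2 := by gcongr
      _ = _ := by ring
  -- Term 2
  have hT2 : g * dn * dr ^ 2 / r * ((r * Q / 2) * (K₂ * dn ^ 2 * (P / r) ^ (1 / 24 : ℝ) * (1 + Real.log (P / r)))) ≤
      X ^ (1 - 5 * δ) * g / 2 := by
    have hre : g * dn * dr ^ 2 / r * ((r * Q / 2) * (K₂ * dn ^ 2 * (P / r) ^ (1 / 24 : ℝ) * (1 + Real.log (P / r)))) =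
        g * (K₂ * (dn ^ 3 * dr ^ 2)) * Q * ((P / r) ^ (1 / 24 : ℝ) * (1 + Real.log (P / r))) / 2 := by
      field_simp
    rw [hre]
    have hQ0 : 0 ≤ Q := by rw [hQ]; exact Real.rpow_nonneg hX0.le _
    calc g * (K₂ * (dn ^ 3 * dr ^ 2)) * Q * ((P / r) ^ (1 / 24 : ℝ) * (1 + Real.log (P / r))) / 2
        ≤ g * (K₂ * (Cd ^ 5 * X ^ (δ / 8))) * Q * (P ^ (1 / 24 : ℝ) * (1 + Real.log P)) / 2 := by
          gcongr
      _ = g * (K₂ * Cd ^ 5 * (1 + 6 * δ * Real.log X)) * X ^ (δ / 8) * (Q * X ^ (δ / 4)) / 2 := by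
          rw [hP24, hlogP]; ring
      _ ≤ g * X ^ (δ / 2) * X ^ (δ / 8) * (Q * X ^ (δ / 4)) / 2 := by gcongr
      _ = g * (X ^ (δ / 2) * X ^ (δ / 8) * (X ^ (1 - 6 * δ) * X ^ (δ / 4))) / 2 := by rw [hQ]; ring
      _ ≤ g * X ^ (1 - 5 * δ) / 2 := by gcongr
      _ = _ := by ring
  rw [mul_add, e3, hg']
  linarith

/-! ### (6.1͂7): the exceptional major-arc formula -/

/-- **(6.1͂7) of Montgomery–Vaughan 1975** (p. 365) — the second conjunct of `section6_formulae c₁`,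
uniformly in `c₁`: there are absolute `C, δ₀ > 0` such that for `0 < δ ≤ δ₀`, `X ≥ X₀(δ)`,
`P = X^{6δ}`, `Q = X^{1−6δ}`, exceptional data `(r̃, χ̃, β̃)` at level `P` (any `c₁`) with `χ̃`
quadratic, and every even `1 ≤ n ≤ X`,
`|R₁(n) − 𝔖(n)(n + (𝔖̃(n)/𝔖(n)) Ĩ(n))| ≤ C (𝟙_{(n,r̃)=1} r̃ n X/(φ(r̃)²φ(n)) + X^{1+δ}P⁻¹(n,r̃)
 + (n/φ(n))(X^{1/2} W + W²))`, `W = errTotalExc P Q X χ̃ β̃`. PROVED (`Section6ExcT`, `Section6ExcRem`,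
`Section6ExcMain`, `Section6Main`). [cite: MontgomeryVaughanActa1975, §6 (6.17~)] -/
theorem majorArc_formula_exceptional :
    ∃ C : ℝ, 0 < C ∧ ∃ δ₀ : ℝ, 0 < δ₀ ∧ ∀ δ : ℝ, 0 < δ → δ ≤ δ₀ → ∃ X₀ : ℝ, ∀ X : ℝ, X₀ ≤ X →
      ∀ (c₁ : ℝ) (r : ℕ) [NeZero r] (χ : DirichletCharacter ℂ r) (β : ℝ),
        IsExceptionalZero c₁ (X ^ (6 * δ)) r χ β → χ ^ 2 = 1 →
      ∀ n : ℕ, 1 ≤ n → (n : ℝ) ≤ X → Even n →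
        ‖majorArcIntegral (X ^ (6 * δ)) (X ^ (1 - 6 * δ)) X n -
            ((goldbachSingularSeries n *
                (n + excRatio χ n * excPairSum (X ^ (6 * δ)) X β n) : ℝ) : ℂ)‖ ≤
          C * ((if n.Coprime r then (r : ℝ) * n * X / ((Nat.totient r : ℝ) ^ 2 * Nat.totient n)
                else 0) +
            X ^ (1 + δ) * (X ^ (6 * δ))⁻¹ * Nat.gcd n r +
            (n : ℝ) / (Nat.totient n : ℝ) *
              (X ^ (1 / 2 : ℝ) * errTotalExc (X ^ (6 * δ)) (X ^ (1 - 6 * δ)) X χ β +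
                errTotalExc (X ^ (6 * δ)) (X ^ (1 - 6 * δ)) X χ β ^ 2)) := by
  obtain ⟨K₁, hK₁0, hK₁⟩ := exists_tail_abs_goldbachSeriesTerm_le
  obtain ⟨K₂, hK₂0, hK₂⟩ := exists_head_sum_mul_abs_goldbachSeriesTerm_le
  obtain ⟨C₀, hC₀, δ₀, hδ₀, H⟩ := majorArc_mainTerm_eval
  refine ⟨C₀ + 1 + 16 * Real.exp 2, by positivity, min δ₀ (1 / 24), lt_min hδ₀ (by norm_num),
    fun δ hδ hδle => ?_⟩
  have hδ₀' : δ ≤ δ₀ := hδle.trans (min_le_left _ _)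
  have hδ24 : δ ≤ 1 / 24 := hδle.trans (min_le_right _ _)
  obtain ⟨X₁, hX₁⟩ := H δ hδ hδ₀'
  obtain ⟨Cd, hCd1, hCd⟩ := exists_card_divisors_le_mul_rpow (ε := δ / 40) (by linarith)
  obtain ⟨X₂, hX₂⟩ := Filter.eventually_atTop.mp
    (eventually_mainTerm_thresholds (A := 2 * K₁ * Cd ^ 5) (B := K₂ * Cd ^ 5) hδ hδ24 (by positivity))
  refine ⟨max X₁ X₂, fun X hX c₁ r _ χ β hEZ hq2 n hn hnX heven => ?_⟩
  obtain ⟨⟨hQ2, hPQ⟩, hmain⟩ := hX₁ X ((le_max_left _ _).trans hX)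
  obtain ⟨hX1, _, _, hA, hB⟩ := hX₂ X ((le_max_right _ _).trans hX)
  obtain ⟨hprim, _, hrP, _, hβ1, _⟩ := hEZ
  have hX0 : 0 < X := by linarith
  have hX0' : 0 ≤ X := hX0.le
  set P : ℝ := X ^ (6 * δ) with hP
  set Q : ℝ := X ^ (1 - 6 * δ) with hQ
  set W : ℝ := errTotalExc P Q X χ β with hW
  have hP0 : 0 ≤ P := Real.rpow_nonneg hX0' _
  have hn0 : n ≠ 0 := by omega
  have hβ : β ≤ 1 := hβ1.le
  have hr1 : 1 ≤ r := NeZero.pos r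
  have hPQX : P * Q = X := by
    rw [hP, hQ, ← Real.rpow_add hX0]; norm_num
  -- the three pieces
  have hrem := majorArc_remainderExc_bound (P := P) (Q := Q) hX0' hP0 hQ2 hPQ hprim hβ hn0
  have hmt := norm_sum_majorArcMainTermExc_sub_le hK₁ hK₂ hQ2 hX0' hprim hq2 hrP hβ hn0 heven
  have hm0 := hmain n hn hnX
  have herr := excIMain_error_le hK₁0.le hK₂0.le (by linarith) hδ hδ24 hX1 hA hB hr1 hrP hnX
    (hCd n hn0) (hCd r (by omega))
  have hA' := abs_excMainCoeff_le' χ hn0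
  -- notation for the target
  set E₁ : ℝ := if n.Coprime r then (r : ℝ) * n * X / ((Nat.totient r : ℝ) ^ 2 * Nat.totient n) else 0 with hE₁
  set E₂ : ℝ := X ^ (1 + δ) * (X ^ (6 * δ))⁻¹ * Nat.gcd n r with hE₂
  set E₃ : ℝ := (n : ℝ) / (Nat.totient n : ℝ) * (X ^ (1 / 2 : ℝ) * W + W ^ 2) with hE₃
  have ht0 : 0 ≤ (n : ℝ) / (Nat.totient n : ℝ) := by positivity
  have hW0 : 0 ≤ W := errTotalExc_nonneg _ _ _ _ _
  have hX2 : 0 ≤ X ^ (1 / 2 : ℝ) := Real.rpow_nonneg hX0' _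
  have hE₁0 : 0 ≤ E₁ := by rw [hE₁]; split_ifs <;> positivity
  have hE₂0 : 0 ≤ E₂ := by rw [hE₂]; positivity
  have hE₃0 : 0 ≤ E₃ := by rw [hE₃]; positivity
  have hgcd1 : (1 : ℝ) ≤ Nat.gcd n r := by exact_mod_cast Nat.gcd_pos_of_pos_left r (by omega)
  have hXP0 : 0 ≤ X ^ (1 + δ) * (X ^ (6 * δ))⁻¹ := by positivity
  -- piece 1: remainder ≤ 16e² E₃
  have h1 : 4 * Real.exp 2 * ((n : ℝ) / (Nat.totient n : ℝ)) * (4 * X ^ (1 / 2 : ℝ) * W + W ^ 2) ≤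
      16 * Real.exp 2 * E₃ := by
    rw [hE₃]
    have he0 : 0 ≤ Real.exp 2 := (Real.exp_pos 2).le
    have p1 : 0 ≤ Real.exp 2 * ((n : ℝ) / (Nat.totient n : ℝ) * (W * W)) :=
      mul_nonneg he0 (mul_nonneg ht0 (mul_nonneg hW0 hW0))
    have heq : 16 * Real.exp 2 * ((n : ℝ) / (Nat.totient n : ℝ) * (X ^ (1 / 2 : ℝ) * W + W ^ 2)) =
        4 * Real.exp 2 * ((n : ℝ) / (Nat.totient n : ℝ)) * (4 * X ^ (1 / 2 : ℝ) * W + W ^ 2) +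
          12 * (Real.exp 2 * ((n : ℝ) / (Nat.totient n : ℝ) * (W * W))) := by ring
    rw [heq]
    linarith
  -- piece 2: the `J̃`-terms ≤ 3e² E₁
  have h2 : 2 * ((n : ℝ) + P * Q / 2) *
      ((if n.Coprime r then (r : ℝ) / (Nat.totient r : ℝ) ^ 2 else 0) *
        (Real.exp 2 * ((n : ℝ) / (Nat.totient n : ℝ)))) ≤ 3 * Real.exp 2 * E₁ := by
    rw [hPQX, hE₁]
    split_ifs with hc
    · have hφr : (0 : ℝ) < Nat.totient r := by exact_mod_cast Nat.totient_pos.mpr (NeZero.pos r)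
      have hφn : (0 : ℝ) < Nat.totient n := by exact_mod_cast Nat.totient_pos.mpr (by omega)
      have hnn : (0 : ℝ) ≤ n := Nat.cast_nonneg n
      have heq : (r : ℝ) / (Nat.totient r : ℝ) ^ 2 * (Real.exp 2 * ((n : ℝ) / (Nat.totient n : ℝ))) =
          Real.exp 2 * ((r : ℝ) * n / ((Nat.totient r : ℝ) ^ 2 * Nat.totient n)) := by
        field_simp
      have heq2 : (r : ℝ) * n * X / ((Nat.totient r : ℝ) ^ 2 * Nat.totient n) =
          (r : ℝ) * n / ((Nat.totient r : ℝ) ^ 2 * Nat.totient n) * X := by ring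
      rw [heq, heq2]
      have hB0 : 0 ≤ (r : ℝ) * n / ((Nat.totient r : ℝ) ^ 2 * Nat.totient n) := by positivity
      have : 2 * ((n : ℝ) + X / 2) ≤ 3 * X := by linarith
      have he0 : 0 ≤ Real.exp 2 := (Real.exp_pos 2).le
      calc 2 * ((n : ℝ) + X / 2) * (Real.exp 2 * ((r : ℝ) * n / ((Nat.totient r : ℝ) ^ 2 * Nat.totient n)))
          ≤ 3 * X * (Real.exp 2 * ((r : ℝ) * n / ((Nat.totient r : ℝ) ^ 2 * Nat.totient n))) :=
            mul_le_mul_of_nonneg_right this (by positivity)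
        _ = _ := by ring
    · simp
  -- piece 3: the `Ĩ`-errors ≤ E₂
  have h3 : |excMainCoeff χ n| *
      (X * (K₁ * (n.divisors.card : ℝ) ^ 2 * (P / r) ^ (-(11 / 12 : ℝ))) +
        (r * Q / 2) * (K₂ * (n.divisors.card : ℝ) ^ 2 * (P / r) ^ (1 / 24 : ℝ) * (1 + Real.log (P / r)))) ≤ E₂ := by
    rw [hE₂]
    refine le_trans (mul_le_mul_of_nonneg_right hA' ?_) herr
    have hr0 : (0 : ℝ) < r := by exact_mod_cast hr1
    have hPr1 : 1 ≤ P / r := by rw [le_div_iff₀ hr0, one_mul]; exact hrP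
    have hlog0 : 0 ≤ 1 + Real.log (P / r) := by have := Real.log_nonneg hPr1; linarith
    have hQ0 : 0 ≤ Q := Real.rpow_nonneg hX0' _
    have hPr0 : 0 ≤ P / r := div_nonneg hP0 hr0.le
    have hd0 : 0 ≤ (n.divisors.card : ℝ) ^ 2 := sq_nonneg _
    apply add_nonneg
    · exact mul_nonneg hX0' (mul_nonneg (mul_nonneg hK₁0.le hd0) (Real.rpow_nonneg hPr0 _))
    · refine mul_nonneg (by positivity) (mul_nonneg (mul_nonneg (mul_nonneg hK₂0.le hd0) (Real.rpow_nonneg hPr0 _)) hlog0)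
  -- piece 4: the non-exceptional main term ≤ C₀ E₂
  have h4 : C₀ * (X ^ (1 + δ) * (X ^ (6 * δ))⁻¹) ≤ C₀ * E₂ := by
    rw [hE₂]
    apply mul_le_mul_of_nonneg_left _ hC₀.le
    calc X ^ (1 + δ) * (X ^ (6 * δ))⁻¹ = X ^ (1 + δ) * (X ^ (6 * δ))⁻¹ * 1 := (mul_one _).symm
      _ ≤ _ := mul_le_mul_of_nonneg_left hgcd1 hXP0
  -- assemble
  set MT := ∑ q ∈ Finset.Icc 1 ⌊P⌋₊, majorArcMainTermExc P Q X χ β n q with hMT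
  calc ‖majorArcIntegral P Q X n - ((goldbachSingularSeries n * (n + excRatio χ n * excPairSum P X β n) : ℝ) : ℂ)‖
      = ‖(majorArcIntegral P Q X n - MT) +
          (MT - ((goldbachSingularSeries n * (n + excRatio χ n * excPairSum P X β n) : ℝ) : ℂ))‖ := by
        congr 1; ring
    _ ≤ ‖majorArcIntegral P Q X n - MT‖ +
          ‖MT - ((goldbachSingularSeries n * (n + excRatio χ n * excPairSum P X β n) : ℝ) : ℂ)‖ :=
        norm_add_le _ _
    _ ≤ 16 * Real.exp 2 * E₃ + (C₀ * E₂ + 3 * Real.exp 2 * E₁ + E₂) := by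
        refine add_le_add (hrem.trans h1) (hmt.trans ?_)
        exact add_le_add (add_le_add (hm0.trans h4) h2) h3
    _ ≤ (C₀ + 1 + 16 * Real.exp 2) * (E₁ + E₂ + E₃) := by
        have he0 : 0 ≤ Real.exp 2 := (Real.exp_pos 2).le
        have p1 := mul_nonneg hC₀.le hE₁0
        have p2 := mul_nonneg hC₀.le hE₃0
        have p3 := mul_nonneg he0 hE₁0
        have p4 := mul_nonneg he0 hE₂0
        have p5 := mul_nonneg he0 hE₃0
        linarith

/-! ### The named fact `section6_formulae` discharged -/

/-- **DISCHARGE of the named fact `section6_formulae c₁`** ((6.17) and (6.1͂7) of Montgomery–Vaughan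
1975, for every value of the constant `c₁` of Lemma 4.1): conjunct (a) is
`majorArc_formula_nonexceptional` (`Section6Main`), conjunct (b) is `majorArc_formula_exceptional`, with
the common constants `C = max`, `δ₀ = min`, `X₀ = max`. [cite: MontgomeryVaughanActa1975, §6 (6.17), (6.17~)] -/
theorem section6_formulae_holds (c₁ : ℝ) : section6_formulae c₁ := by
  obtain ⟨Ca, hCa, δa, hδa, Ha⟩ := majorArc_formula_nonexceptional
  obtain ⟨Cb, hCb, δb, hδb, Hb⟩ := majorArc_formula_exceptional
  refine ⟨max Ca Cb, lt_max_of_lt_left hCa, min δa δb, lt_min hδa hδb, fun δ hδ hδle => ?_⟩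
  obtain ⟨Xa, hXa⟩ := Ha δ hδ (hδle.trans (min_le_left _ _))
  obtain ⟨Xb, hXb⟩ := Hb δ hδ (hδle.trans (min_le_right _ _))
  refine ⟨max (max Xa Xb) 0, fun X hX => ⟨fun n hn hnX => ?_, fun r _ χ β hEZ hq2 n hn hnX heven => ?_⟩⟩
  · have h := hXa X ((le_max_left _ _).trans ((le_max_left _ _).trans hX)) n hn hnX
    refine h.trans (mul_le_mul_of_nonneg_right (le_max_left _ _) ?_)
    have hX0 : 0 ≤ X := (le_max_right _ _).trans hX
    have := errTotal_nonneg (X ^ (6 * δ)) (X ^ (1 - 6 * δ)) X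
    positivity
  · have h := hXb X ((le_max_right _ _).trans ((le_max_left _ _).trans hX)) c₁ r χ β hEZ hq2 n hn hnX heven
    refine h.trans (mul_le_mul_of_nonneg_right (le_max_right _ _) ?_)
    have hX0 : 0 ≤ X := (le_max_right _ _).trans hX
    have := errTotalExc_nonneg (X ^ (6 * δ)) (X ^ (1 - 6 * δ)) X χ β
    have h1 : 0 ≤ (if n.Coprime r then (r : ℝ) * n * X / ((Nat.totient r : ℝ) ^ 2 * Nat.totient n) else 0) := by
      split_ifs <;> positivity
    positivity

/-! ### Theorem 1 of the paper from LEMMA 4.3 alone -/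

/-- The §6 formulae hold at some (indeed every) level `c₁ > 0` — the hypothesis
`∃ c₁ > 0, section6_formulae c₁` of the reductions in `MontgomeryVaughan1975Lemma43.lean`.
[cite: MontgomeryVaughanActa1975, §6 (6.17), (6.17~)] -/
theorem section6_formulae_exists : ∃ c₁ : ℝ, 0 < c₁ ∧ section6_formulae c₁ :=
  ⟨1, one_pos, section6_formulae_holds 1⟩

/-- **Theorem 1 of Montgomery–Vaughan 1975 from `lemma43At c₁` for a small `c₁`** (the reduction of
`Section7` with the §6 input discharged). [cite: MontgomeryVaughanActa1975, Theorem 1] -/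
theorem goldbachExceptionalCount_isBigO_rpow_of_lemma43At' :
    ∃ c : ℝ, 0 < c ∧ ∀ c₁ : ℝ, 0 < c₁ → c₁ < c → lemma43At c₁ →
      Literature.NumberTheory.Sieve.goldbachExceptionalCount_isBigO_rpow := by
  obtain ⟨c, hc, h⟩ := goldbachExceptionalCount_isBigO_rpow_of_lemma43At
  exact ⟨c, hc, fun c₁ hc₁ hc₁c h43 => h c₁ hc₁ hc₁c h43 (section6_formulae_holds c₁)⟩

/-- **(8.3) of Montgomery–Vaughan 1975 from the named fact `lemma43_gallagher` alone** (the tree's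
`majorArc_lowerBound_of_lemma43_gallagher` with its §6 hypothesis discharged by
`section6_formulae_exists`). [cite: MontgomeryVaughanActa1975, §8 (8.3)] -/
theorem majorArc_lowerBound_of_lemma43 (h43 : lemma43_gallagher) : majorArc_lowerBound :=
  majorArc_lowerBound_of_lemma43_gallagher h43 section6_formulae_exists

/-- **Theorem 1 of Montgomery–Vaughan 1975 (parity.S15) from the named fact `lemma43_gallagher`
alone**: LEMMA 4.3 = Gallagher 1970, Theorem 7 (as modified) implies `E(X) ≪ X^{1−δ}`; Lemmas 4.1,
4.2, §§5–8 (including now (6.1͂7)) and the minor arcs are PROVED in the tree (the tree's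
`Literature.NumberTheory.Sieve.goldbachExceptionalCount_isBigO_rpow_of_lemma43_gallagher` with its §6
hypothesis discharged). [cite: MontgomeryVaughanActa1975, Theorem 1] -/
theorem goldbachExceptionalCount_isBigO_rpow_of_lemma43 (h43 : lemma43_gallagher) :
    Literature.NumberTheory.Sieve.goldbachExceptionalCount_isBigO_rpow :=
  Literature.NumberTheory.Sieve.goldbachExceptionalCount_isBigO_rpow_of_lemma43_gallagher h43
    section6_formulae_exists

end Literature.NumberTheory.Sieve.MontgomeryVaughan1975
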